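import Literature.NumberTheory.LFunctions.BurnolZetaSystemsHardy
import Literature.NumberTheory.LFunctions.SonineExtendedMellinContinuation
import Literature.NumberTheory.LFunctions.BurnolSonineFourier
import Literature.NumberTheory.LFunctions.ZetaZerosProofs
import Literature.Analysis.Complex.RectangleResiduePolarParts
import Literature.Analysis.Complex.VerticalStripResidues
import Literature.Analysis.SpecialFunctions.GammaStirlingVertical
import HarnessLib

/-!
# Burnol 2004b, Prop. 5.4: `0 = Σ_ρ G(ρ)/ζ′(ρ)` for `G ∈ 𝓛̂₁` — DISCHARGE of `Burnol2004b_prop5_4`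

LINE 1 — LABEL: RH-FREE (an identity between residues of `G(s)/ζ(s)` at the non-trivial zeros of `ζ`,
WHATEVER they are, and two vertical line integrals that vanish; no hypothesis and no conclusion on the
location of the zeros). FRAMING (cell rh-crit, D-0074): corpus theorems are RH-FREE literature; nothing here
is worded as progress toward RH. bears_on: B-C/B-P (LADDER-RH COLUMN 6, de Branges framework). WHAT THIS
IS NOT: not a route, not a criterion, no positivity at `E_ζ`; discharging a printed 2004 identity fixes
corpus vocabulary and moves RH by nothing. Nothing here bears on the truth of RH.

Source: J.-F. Burnol, *Two complete and minimal systems associated with the zeros of the Riemann zeta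
function*, J. Théor. Nombres Bordeaux **16** (2004) 65–94 = arXiv:math/0203120v7 [Burnol2004b], Prop. 5.4
(p. 14, TeX of record `rh-crit/dbl/src/Burnol2004JTNB_arXivmath0203120v7.tex` l.1131–1174) with Note 5
(TeX l.964–985: `Σ_ρ := lim_n Σ_{|Im ρ| < T_n}`, "absolutely convergent" = the blocks
`T_n ≤ |Im ρ| < T_{n+1}` are summable in norm) and Prop. 5.1 (Titchmarsh's Theorem 9.7, the height
sequence `T_n`).

## What is PROVED (theorem-only module: no definition, no named fact)

* `Burnol2004b_prop5_4_holds : Burnol2004b_prop5_4` — for every height sequence `(A, T_n)` with the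
  property of Prop. 5.1 (`IsInvZetaHeightSeq A T`) and every `g ∈ 𝓛₁` (`burnolScriptL1`): the partial
  sums `S_n = Σ_{|Im ρ| < T_n} Res_{s=ρ} G(s)/ζ(s)` (`burnolInvZetaResiduePartialSum`, `G = G_g =
  rightMellinExt g`) have summable increments and tend to `0`.

Public by-products (namespace `BurnolResidueSum`): `rectBoundaryIntegral_eq_sum_residueAt` (the residue
theorem on a rectangle for finitely many MEROMORPHIC singularities, in the `residueAt` vocabulary of
`CircleResidue.lean` — the tree had it for prescribed polar parts only); `zeta_ne_zero_of_isInvZetaHeightSeq`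
(no zero of `ζ` on a Prop-5.1 line); the strip decomposition `mellin_eq_const_div_add_mellin_trunc`, its
absolute convergence `integrableOn_cpow_smul` and continuation `rightMellinExt_eq_of_half_lt_re`
(`G_h(s) = c/(1−s) + ∫_1^∞ h t^{−s}` on `Re s > 1/2`); `div_zeta_eventuallyEq_near_one` (`s = 1` is not a
singularity of `G/ζ`); `integral_div_zeta_line_two_eq_zero` (Möbius term by term on `σ = 2`);
`div_zeta_neg_one_line` (`σ = −1 ↦ σ = 2` by the two functional equations); `exists_fourier_strip_decay`
(decay of `G_{𝓕g}` on `σ′ ≤ Re ≤ 2`); Lemma K `integral_line_two_mul_cpow_eq_zero` with its two halves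
`integral_line_two_sub_line_eq` (contour shift) and `integral_line_mul_cpow_eq` (Mellin inversion). The
remaining helpers are private `[folklore]` plumbing.

## The printed proof (TeX l.1146–1174) and how it is followed

"the series is absolutely convergent and its value is `(1/2π)(∫_{σ=2} − ∫_{σ=−1}) G(s)/ζ(s)|ds|`" — §D:
the residue theorem on `[−1,2] × [−T_n,T_n]` (poles: the zeros with `|Im ρ| < T_n`; `s = 1` is
removable, simple pole of `G` against simple zero of `1/ζ`), the horizontal sides are
`O(T_n^{A−N}) → 0` by Prop. 5.1 and the decay of `G ∈ 𝓛̂₁`, the vertical sides converge, and the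
increments `S_{n+1} − S_n` are bounded by the tails of two convergent integrals plus `O(n^{−2})`.
"We prove that the `σ = 2` integral vanishes … Using on `σ = 2` the absolutely convergent expression
`1/ζ(s) = Σ_{k≥1} μ(k)k^{−s}` it will be enough to prove `0 = (1/2π)∫_{σ=2} G(s)k^{−s}|ds|`. We shift the
integral to the critical line and obtain `(1/2π)∫_{σ=1/2} G(s)k^{−s}|ds| + Res_1(G)/k` … `f(t) = c/t` for
`t ≥ 1` … `Res_1(G) = −c`, and on the other hand `f(k) = +c/k`" — §C (`BurnolResidueSum.integral_line_two_mul_cpow_eq_zero`):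
DEVIATION (said once): instead of the `L²` Fourier–Mellin inversion on the critical line followed by a
smoothness argument, we shift to a line `1/2 < σ′ < 1` INSIDE the strip of absolute convergence of
`ĝ(s) = ∫_0^∞ g(t)t^{−s}dt` and apply Mathlib's `L¹` Mellin inversion theorem (`mellinInv_mellin_eq`) at
the continuity points `1/k ∈ (0,1)` of `g` (where `g ≡ c`), and at `x = 1` (`k = 1`) the continuity of the
absolutely convergent inverse integral; the residue at `s = 1` is read off the strip decomposition
`ĝ(s) = c/(1−s) + ∫_1^∞ g(t)t^{−s}dt` (Burnol 2004, proof of Thm. 6.10). Same identity, no Plancherel.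
"and the `σ = −1` integral will then too also from the functional equation
`G(1−s)/ζ(1−s) = 𝓕₊(G)(s)/ζ(s)` where `𝓕₊(G)` also belongs to `𝓛̂₁`" — §E: the functional equations of
`ζ` (Mathlib `completedRiemannZeta_one_sub`) and of `G` (Prop. 2.2 (v), dbl-t14's
`rightMellinExt_functionalEquation_of_mem_sonineL`) give `G(s)/ζ(s) = H(1−s)/ζ(1−s)` with
`H = G_{𝓕g}`; of "`𝓕₊(G) ∈ 𝓛̂₁`" (Lemma 4.10) only the decay of `H` on `1/2 < σ′ ≤ Re ≤ 2` is needed and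
it is PROVED here from the decay of `G` on `−1 ≤ Re ≤ 1−σ′` and Stirling's ratio bound
(`exists_norm_Gamma_vertical_ratio_le`).
-/

noncomputable section

open MeasureTheory Complex Filter Set Topology intervalIntegral
open scoped ComplexConjugate FourierTransform ENNReal Real

namespace Literature.NumberTheory.LFunctions

namespace BurnolResidueSum

open Literature.Analysis.Complex

/-! ## §A. The residue theorem on a rectangle in the `residueAt` vocabulary -/

/-- A principal part `Σ_{k<m} b_k (z−p)^{−(k+1)}` is the tree's `polarPart p (m−1)` (and `0` for `m = 0`).
[folklore] -/
private theorem sum_zpow_neg_eq_polarPart (p : ℂ) (m : ℕ) (co : ℕ → ℂ) (z : ℂ) :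
    (∑ k ∈ Finset.range m, co k * (z - p) ^ (-(k + 1 : ℤ))) =
      polarPart p (m - 1) (if 0 < m then co else 0) z := by
  rcases Nat.eq_zero_or_pos m with rfl | hm
  · simp [polarPart]
  · rw [if_pos hm, polarPart, Nat.sub_add_cancel hm]
    refine Finset.sum_congr rfl fun k _ ↦ ?_
    have : (z - p) ^ (-(k + 1 : ℤ)) = ((z - p) ^ (k + 1))⁻¹ := by
      rw [zpow_neg, show ((k : ℤ) + 1) = ((k + 1 : ℕ) : ℤ) by push_cast; ring, zpow_natCast]
    rw [this, div_eq_mul_inv]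

/-- **Residue theorem on a rectangle, finitely many meromorphic singularities.** Let `K = [a,b] × [c,d]`
(`a < b`, `c < d`), `U ⊇ K` open, `S ⊆ K°` finite, `F` complex differentiable on `U ∖ S` and meromorphic
at each point of `S`. Then `∮_{∂K} F = 2πi Σ_{p ∈ S} Res_p F` (four-term convention of Mathlib; the
residue is the tree's small-circle `residueAt`). [cite: Conway1978, Ch. V Thm. 2.2] -/
theorem rectBoundaryIntegral_eq_sum_residueAt {a b c d : ℝ} (hab : a < b) (hcd : c < d)
    (S : Finset ℂ) (F : ℂ → ℂ) (U : Set ℂ) (hU : IsOpen U) (hKU : Icc a b ×ℂ Icc c d ⊆ U)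
    (hS : (S : Set ℂ) ⊆ Ioo a b ×ℂ Ioo c d) (hF : DifferentiableOn ℂ F (U \ ↑S))
    (hmer : ∀ p ∈ S, MeromorphicAt F p) :
    rectBoundaryIntegral F a b c d = 2 * Real.pi * I * ∑ p ∈ S, residueAt F p := by
  classical
  have hpp : ∀ p ∈ S, ∃ (m : ℕ) (co : ℕ → ℂ) (g : ℂ → ℂ), AnalyticAt ℂ g p ∧
      (∀ᶠ z in 𝓝[≠] p, F z = (∑ k ∈ Finset.range m, co k * (z - p) ^ (-(k + 1 : ℤ))) + g z) :=
    fun p hp ↦ exists_principalPart (hmer p hp)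
  choose! m co g hga hdec using hpp
  have key := rectBoundaryIntegral_eq_sum_of_polarParts hab hcd S F (fun p ↦ m p - 1)
    (fun p ↦ if 0 < m p then co p else 0) U hU hKU hS hF ?_
  · rw [key]
    congr 1
    refine Finset.sum_congr rfl fun p hp ↦ ?_
    rw [residueAt_eq_of_principalPart (hga p hp) (hdec p hp)]
    by_cases h : 0 < m p <;> simp [h]
  · intro p hp
    have h1 : ∀ᶠ z in 𝓝 p, z ≠ p →
        F z = (∑ k ∈ Finset.range (m p), co p k * (z - p) ^ (-(k + 1 : ℤ))) + g p z :=
      eventually_nhdsWithin_iff.1 (hdec p hp)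
    have h2 : ∀ᶠ z in 𝓝 p, AnalyticAt ℂ (g p) z := (hga p hp).eventually_analyticAt
    refine ⟨g p, {z | (z ≠ p → F z = (∑ k ∈ Finset.range (m p), co p k * (z - p) ^ (-(k + 1 : ℤ))) +
      g p z) ∧ AnalyticAt ℂ (g p) z}, h1.and h2, fun z hz ↦ hz.2.differentiableAt.differentiableWithinAt,
      fun z hz hzp ↦ ?_⟩
    rw [hz.1 hzp, sum_zpow_neg_eq_polarPart, add_comm]


/-! ## §B. Tools: decay on vertical lines, the zeros of `ζ`, `1/ζ` on `Re s = 2` -/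

/-- A continuous function on `ℝ` dominated by `C/(1+y²)` is integrable. [folklore] -/
private theorem integrable_of_norm_le_div_one_add_sq {φ : ℝ → ℂ} (hφ : Continuous φ) {C : ℝ}
    (h : ∀ y, ‖φ y‖ ≤ C / (1 + y ^ 2)) : Integrable φ := by
  refine Integrable.mono' ((integrable_inv_one_add_sq).const_mul C) hφ.aestronglyMeasurable
    (Eventually.of_forall fun y ↦ ?_)
  simpa [div_eq_mul_inv] using h y

/-- `rightMellinExt g` is differentiable off `s = 1` for `g ∈ L_1`. [cite: Burnol2004b, Prop. 2.2 (arXiv:math/0203120v7 p. 5)] -/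
theorem differentiableAt_rightMellinExt {g : Lp ℂ 2 (volume : Measure ℝ)} (hg : g ∈ sonineL 1)
    {s : ℂ} (hs : s ≠ 1) : DifferentiableAt ℂ (rightMellinExt g) s :=
  ((hasRightMellinContinuation_rightMellinExt_of_mem_sonineL one_pos hg).1 s hs).differentiableAt
    (isOpen_ne.mem_nhds hs)

/-- Continuity of `y ↦ G(σ + iy)` on a line `σ ≠ 1`. [folklore] -/
private theorem continuous_rightMellinExt_line {g : Lp ℂ 2 (volume : Measure ℝ)} (hg : g ∈ sonineL 1)
    {σ : ℝ} (hσ : σ ≠ 1) : Continuous fun y : ℝ ↦ rightMellinExt g (σ + y * I) := by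
  refine continuous_iff_continuousAt.2 fun y ↦ ?_
  have hne : (σ : ℂ) + y * I ≠ 1 := fun h ↦ hσ (by simpa using congrArg Complex.re h)
  exact (differentiableAt_rightMellinExt hg hne).continuousAt.comp
    (f := fun y : ℝ ↦ (σ : ℂ) + y * I) (x := y) (by fun_prop)

/-- **Decay on a vertical line from a strip estimate.** If `Φ` is continuous along the line
`Re s = σ` and `‖Φ(s)‖ ≤ C/(Im s)²` for `|Im s| ≥ 1` on it, then `‖Φ(σ+iy)‖ ≤ C'/(1+y²)` for all `y`.
[folklore] -/
private theorem exists_norm_le_div_one_add_sq {Φ : ℂ → ℂ} {σ : ℝ} (hc : Continuous fun y : ℝ ↦ Φ (σ + y * I))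
    {C : ℝ} (hC : ∀ y : ℝ, 1 ≤ |y| → ‖Φ (σ + y * I)‖ ≤ C / y ^ 2) :
    ∃ C' : ℝ, ∀ y : ℝ, ‖Φ (σ + y * I)‖ ≤ C' / (1 + y ^ 2) := by
  obtain ⟨M, hM⟩ := (isCompact_Icc (a := (-1 : ℝ)) (b := 1)).exists_bound_of_continuousOn
    (f := fun y : ℝ ↦ Φ (σ + y * I)) hc.continuousOn
  refine ⟨2 * (max C 0 + max M 0), fun y ↦ ?_⟩
  have h1 : 0 < 1 + y ^ 2 := by positivity
  rw [le_div_iff₀ h1]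
  rcases le_or_gt 1 |y| with hy | hy
  · have hb := hC y hy
    have hy2 : 1 ≤ y ^ 2 := by nlinarith [sq_abs y]
    have hC0 : C / y ^ 2 ≤ max C 0 / y ^ 2 := by gcongr; exact le_max_left _ _
    have hC1 : max C 0 / y ^ 2 * (1 + y ^ 2) ≤ 2 * max C 0 := by
      rw [div_mul_eq_mul_div, div_le_iff₀ (by positivity)]
      nlinarith [le_max_right C 0]
    calc ‖Φ (σ + y * I)‖ * (1 + y ^ 2) ≤ max C 0 / y ^ 2 * (1 + y ^ 2) := by gcongr; exact hb.trans hC0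
      _ ≤ 2 * (max C 0 + max M 0) := by nlinarith [le_max_right M 0]
  · have hyI : y ∈ Icc (-1 : ℝ) 1 := ⟨by linarith [neg_abs_le y, hy.le], by linarith [le_abs_self y]⟩
    have hb := hM y hyI
    have hy2 : y ^ 2 ≤ 1 := by nlinarith [sq_abs y, abs_nonneg y]
    calc ‖Φ (σ + y * I)‖ * (1 + y ^ 2) ≤ max M 0 * 2 := by
          gcongr
          · exact hb.trans (le_max_left _ _)
          · linarith
      _ ≤ 2 * (max C 0 + max M 0) := by nlinarith [le_max_right C 0]

/-- For `g ∈ 𝓛₁`: `‖G(σ+iy)‖ ≤ C/(1+y²)` on every vertical line `σ ≠ 1`. [cite: Burnol2004b, §4 Definition of 𝓛₁ (arXiv:math/0203120v7 p. 10)] -/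
theorem exists_norm_line_le_of_mem_scriptL1 {g : Lp ℂ 2 (volume : Measure ℝ)} (hg : g ∈ burnolScriptL1)
    {σ : ℝ} (hσ : σ ≠ 1) : ∃ C : ℝ, ∀ y : ℝ, ‖rightMellinExt g (σ + y * I)‖ ≤ C / (1 + y ^ 2) := by
  obtain ⟨C, hC⟩ := hg.2 σ σ 2
  refine exists_norm_le_div_one_add_sq (continuous_rightMellinExt_line hg.1 hσ) (C := C) fun y hy ↦ ?_
  have h := hC (σ + y * I) (by simp) (by simp) (by simpa using hy)
  have hy0 : 0 < |y| := by linarith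
  have hn : |y| ≤ ‖(σ : ℂ) + y * I‖ := by simpa using abs_im_le_norm ((σ : ℂ) + y * I)
  have hC0 : 0 ≤ C := by
    by_contra hneg
    have : ‖rightMellinExt g (σ + y * I)‖ < 0 :=
      h.trans_lt (mul_neg_of_neg_of_pos (not_le.1 hneg) (Real.rpow_pos_of_pos (hy0.trans_le hn) _))
    exact absurd this (not_lt.2 (norm_nonneg _))
  have hpow : ‖(σ : ℂ) + y * I‖ ^ (-((2 : ℕ) : ℝ)) ≤ |y| ^ (-((2 : ℕ) : ℝ)) :=
    Real.rpow_le_rpow_of_nonpos hy0 hn (by norm_num)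
  calc ‖rightMellinExt g (σ + y * I)‖ ≤ C * ‖(σ : ℂ) + y * I‖ ^ (-((2 : ℕ) : ℝ)) := h
    _ ≤ C * |y| ^ (-((2 : ℕ) : ℝ)) := mul_le_mul_of_nonneg_left hpow hC0
    _ = C / y ^ 2 := by
        rw [Real.rpow_neg (abs_nonneg _), show ((2 : ℕ) : ℝ) = (2 : ℕ) by norm_num, Real.rpow_natCast,
          sq_abs, div_eq_mul_inv]

/-- For `g ∈ 𝓛₁`, `G` is integrable along every vertical line `σ ≠ 1`. [folklore] -/
private theorem integrable_line_of_mem_scriptL1 {g : Lp ℂ 2 (volume : Measure ℝ)} (hg : g ∈ burnolScriptL1)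
    {σ : ℝ} (hσ : σ ≠ 1) : Integrable fun y : ℝ ↦ rightMellinExt g (σ + y * I) := by
  obtain ⟨C, hC⟩ := exists_norm_line_le_of_mem_scriptL1 hg hσ
  exact integrable_of_norm_le_div_one_add_sq (continuous_rightMellinExt_line hg.1 hσ) hC

/-! ### The zeros of `ζ` -/

/-- A zero of `ζ` with `−1 ≤ Re s` is a non-trivial zero, hence `0 < Re s < 1`. [folklore] -/
private theorem mem_ntz_of_zero {s : ℂ} (h0 : riemannZeta s = 0) (h1 : -1 ≤ s.re) :
    s ∈ ZetaZeros.riemannZetaNontrivialZeros ∧ 0 < s.re ∧ s.re < 1 := by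
  have hmem : s ∈ ZetaZeros.riemannZetaNontrivialZeros := by
    refine ⟨h0, ?_⟩
    rintro ⟨n, rfl⟩
    have : (-2 * ((n : ℂ) + 1)).re = -2 * (n + 1) := by simp
    rw [this] at h1
    have : (0 : ℝ) ≤ n := n.cast_nonneg
    linarith
  have h := mem_riemannZetaNontrivialZeros_iff_holds.1 hmem
  exact ⟨hmem, h.2.1, h.2.2⟩

/-- The non-trivial zeros below height `T` form a finite set. [folklore] -/
private theorem ntz_below_finite (T : ℝ) :
    {ρ : ℂ | ρ ∈ ZetaZeros.riemannZetaNontrivialZeros ∧ |ρ.im| < T}.Finite := by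
  refine (((isCompact_Icc (a := (0 : ℝ)) (b := 1)).reProdIm
    (isCompact_Icc (a := -T) (b := T))).inter_riemannZetaZeros_finite).subset ?_
  rintro ρ ⟨hρ, hT⟩
  have h := mem_riemannZetaNontrivialZeros_iff_holds.1 hρ
  exact ⟨Complex.mem_reProdIm.2 ⟨⟨h.2.1.le, h.2.2.le⟩, abs_lt.1 hT |>.imp le_of_lt le_of_lt⟩, h.1⟩

/-- **No zero of `ζ` lies on a good horizontal line.** If `|1/ζ(s)| < |s|^A` on `|Im s| = T_n`,
`−1 ≤ Re s ≤ 2` (read with Lean's `0⁻¹ = 0`, so a priori vacuous AT a zero), then in fact `ζ ≠ 0`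
there: near a zero `ρ` on the line, `1/|ζ|` is unbounded along the line while `|s|^A` stays bounded.
[cite: Burnol2004b, Prop. 5.1 (arXiv:math/0203120v7 p. 11)] -/
theorem zeta_ne_zero_of_isInvZetaHeightSeq {A : ℝ} {T : ℕ → ℝ} (hT : IsInvZetaHeightSeq A T) (n : ℕ)
    {s : ℂ} (hs : |s.im| = T n) (h1 : -1 ≤ s.re) : riemannZeta s ≠ 0 := by
  intro h0
  obtain ⟨-, hre0, hre1⟩ := mem_ntz_of_zero h0 h1
  have hs1 : s ≠ 1 := fun h ↦ by simp [h] at hre1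
  -- points `s + ε` on the same line, `ε → 0⁺`
  set ε : ℕ → ℝ := fun j ↦ 1 / ((j : ℝ) + 2) with hε
  have hε0 : ∀ j, 0 < ε j := fun j ↦ by positivity
  have hεle : ∀ j, ε j ≤ 1 / 2 := fun j ↦ by
    rw [hε]; simp only
    rw [div_le_div_iff₀ (by positivity) (by norm_num)]
    have : (0 : ℝ) ≤ j := j.cast_nonneg
    linarith
  have hεt : Tendsto ε atTop (𝓝 0) := by
    have h : Tendsto (fun j : ℕ ↦ (j : ℝ) + 2) atTop atTop :=
      tendsto_natCast_atTop_atTop.atTop_add tendsto_const_nhds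
    have h2 := h.inv_tendsto_atTop
    refine h2.congr fun j ↦ ?_
    simp [hε, one_div]
  have hcont : ContinuousAt riemannZeta s := (differentiableAt_riemannZeta hs1).continuousAt
  have hlim : Tendsto (fun j ↦ riemannZeta (s + ε j)) atTop (𝓝 0) := by
    have : Tendsto (fun j ↦ s + (ε j : ℂ)) atTop (𝓝 s) := by
      simpa using tendsto_const_nhds.add (Complex.continuous_ofReal.continuousAt.tendsto.comp hεt)
    have h2 := hcont.tendsto.comp this
    rw [h0] at h2
    exact h2
  -- the bound `‖s + ε‖^A` stays bounded
  have hspos : 0 < ‖s‖ := norm_pos_iff.2 fun h ↦ by simp [h] at hre0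
  have hpow : Tendsto (fun j ↦ ‖s + (ε j : ℂ)‖ ^ A) atTop (𝓝 (‖s‖ ^ A)) := by
    have h1 : Tendsto (fun j ↦ ‖s + (ε j : ℂ)‖) atTop (𝓝 ‖s‖) := by
      have : Tendsto (fun j ↦ s + (ε j : ℂ)) atTop (𝓝 s) := by
        simpa using tendsto_const_nhds.add (Complex.continuous_ofReal.continuousAt.tendsto.comp hεt)
      exact (continuous_norm.tendsto s).comp this
    exact ((Real.continuousAt_rpow_const _ _ (Or.inl hspos.ne')).tendsto).comp h1
  have hbdd : ∀ᶠ j in atTop, ‖s + (ε j : ℂ)‖ ^ A ≤ ‖s‖ ^ A + 1 :=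
    hpow.eventually (eventually_le_nhds (by linarith))
  -- isolated zeros: eventually `ζ(s + ε j) ≠ 0`
  have hiso : ∀ᶠ j in atTop, riemannZeta (s + ε j) ≠ 0 := by
    have hev : ∀ᶠ z in 𝓝[≠] s, riemannZeta z ≠ 0 := by
      have h := (isDiscrete_iff_nhdsNE.1 isDiscrete_riemannZetaZeros) s h0
      rw [Filter.inf_principal_eq_bot] at h
      filter_upwards [h] with z hz
      simpa [mem_riemannZetaZeros] using hz
    have hu : Tendsto (fun j ↦ s + (ε j : ℂ)) atTop (𝓝[≠] s) := by
      refine tendsto_nhdsWithin_iff.2 ⟨?_, Eventually.of_forall fun j ↦ ?_⟩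
      · simpa using tendsto_const_nhds.add (Complex.continuous_ofReal.continuousAt.tendsto.comp hεt)
      · have : (ε j : ℂ) ≠ 0 := ofReal_ne_zero.2 (hε0 j).ne'
        simpa using this
    exact hu.eventually hev
  -- along the sequence the hypothesis gives `‖ζ(s+ε)‖ > 1/M`, contradicting `ζ(s+ε) → 0`
  set M : ℝ := ‖s‖ ^ A + 1 with hM
  have hM0 : 0 < M := by have := Real.rpow_pos_of_pos hspos A; rw [hM]; linarith
  have hlow : ∀ᶠ j in atTop, M⁻¹ < ‖riemannZeta (s + ε j)‖ := by
    filter_upwards [hiso, hbdd] with j hj hb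
    have hT' := hT.2.2 n (s + ε j) (by simpa using hs) (by simp; linarith [hε0 j])
      (by simp; linarith [hεle j])
    have hpos : 0 < ‖riemannZeta (s + ε j)‖ := norm_pos_iff.2 hj
    have h3 : ‖riemannZeta (s + (ε j : ℂ))‖⁻¹ < M := hT'.trans_le hb
    exact (inv_lt_comm₀ hpos hM0).1 h3
  have hsmall : ∀ᶠ j in atTop, ‖riemannZeta (s + ε j)‖ < M⁻¹ := by
    have := (tendsto_zero_iff_norm_tendsto_zero.1 hlim).eventually (eventually_lt_nhds (inv_pos.2 hM0))
    exact this
  obtain ⟨j, hj1, hj2⟩ := (hlow.and hsmall).exists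
  exact lt_irrefl _ (hj1.trans hj2)


/-! ### The strip decomposition `ĝ(s) = c/(1−s) + ∫_1^∞ g(t)t^{−s}dt` and its continuation to `Re s > 1/2` -/

/-- `𝟙_{(1,∞)}(t)·t^{w−1} ∈ L²(ℝ)` for `Re w < 1/2`. [folklore] -/
private theorem memLp_indicator_cpow {w : ℂ} (hw : w.re < 1 / 2) :
    MemLp (Set.indicator (Ioi (1 : ℝ)) (fun t : ℝ ↦ (t : ℂ) ^ (w - 1))) 2 volume := by
  have hmeas : Measurable (Set.indicator (Ioi (1 : ℝ)) (fun t : ℝ ↦ (t : ℂ) ^ (w - 1))) :=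
    (Complex.measurable_ofReal.pow_const _).indicator measurableSet_Ioi
  rw [memLp_two_iff_integrable_sq_norm hmeas.aestronglyMeasurable]
  have h1 : IntegrableOn (fun x : ℝ ↦ x ^ (2 * (w.re - 1))) (Ioi 1) :=
    integrableOn_Ioi_rpow_of_lt (by linarith) one_pos
  have h2 : Integrable (Set.indicator (Ioi (1 : ℝ)) (fun x : ℝ ↦ x ^ (2 * (w.re - 1)))) :=
    h1.integrable_indicator measurableSet_Ioi
  refine h2.congr (Eventually.of_forall fun x ↦ ?_)
  change _ = ‖Set.indicator (Ioi (1 : ℝ)) (fun t : ℝ ↦ (t : ℂ) ^ (w - 1)) x‖ ^ 2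
  by_cases hx : x ∈ Ioi (1 : ℝ)
  · have hx0 : (0 : ℝ) < x := lt_trans one_pos hx
    rw [Set.indicator_of_mem hx, Set.indicator_of_mem hx, Complex.norm_cpow_eq_rpow_re_of_pos hx0,
      ← Real.rpow_natCast, ← Real.rpow_mul hx0.le]
    congr 1
    simp; ring
  · rw [Set.indicator_of_notMem hx, Set.indicator_of_notMem hx]; simp

section Strip

variable (h h₁ : Lp ℂ 2 (volume : Measure ℝ))
  (hh₁ : ∀ᵐ x : ℝ, h₁ x = Set.indicator {x : ℝ | 1 < |x|} (h : ℝ → ℂ) x)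

include hh₁ in
/-- The truncation `𝟙_{|x|>1}h` vanishes a.e. on `[−1, 1]`. [folklore] -/
private theorem trunc_ae_zero : ∀ᵐ x : ℝ, x ∈ Icc (-1 : ℝ) 1 → h₁ x = 0 := by
  filter_upwards [hh₁] with x hx hxI
  rw [hx, Set.indicator_of_notMem]
  simp only [mem_setOf_eq, not_lt]
  exact abs_le.2 ⟨hxI.1, hxI.2⟩

include hh₁ in
/-- `t^{w−1}·(𝟙_{|x|>1}h)(t)` is integrable on `(0,∞)` for `Re w < 1/2` (Cauchy–Schwarz). [folklore] -/
private theorem integrableOn_cpow_smul_trunc {w : ℂ} (hw : w.re < 1 / 2) :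
    IntegrableOn (fun t : ℝ ↦ (t : ℂ) ^ (w - 1) • (h₁ : ℝ → ℂ) t) (Ioi 0) := by
  have h1 : Integrable (fun x ↦ (h₁ : ℝ → ℂ) x *
      Set.indicator (Ioi (1 : ℝ)) (fun t : ℝ ↦ (t : ℂ) ^ (w - 1)) x) :=
    (Lp.memLp h₁).integrable_mul (memLp_indicator_cpow hw)
  refine (h1.integrableOn (s := Ioi 0)).congr_fun_ae ?_
  filter_upwards [ae_restrict_mem measurableSet_Ioi, ae_restrict_of_ae (s := Ioi 0) hh₁] with x hx hgx
  have hx' : (0 : ℝ) < x := hx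
  by_cases hxa : (1 : ℝ) < x
  · rw [Set.indicator_of_mem (show x ∈ Ioi (1 : ℝ) from hxa), smul_eq_mul, mul_comm]
  · rw [Set.indicator_of_notMem (show x ∉ Ioi (1 : ℝ) from hxa), hgx, Set.indicator_of_notMem]
    · simp
    · simpa [abs_of_pos hx'] using hxa

include hh₁ in
/-- The a.e. decomposition `t^{w−1}h(t) = 𝟙_{(0,1)}(t)·c·t^{w−1} + t^{w−1}(𝟙_{t>1}h)(t)` on `(0,∞)` for
`h = c` a.e. on `(0,1)`. [folklore] -/
private theorem cpow_smul_ae_eq_decomp {c : ℂ} (hc : ∀ᵐ x : ℝ, x ∈ Ioo (0 : ℝ) 1 → h x = c) (w : ℂ) :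
    (fun t : ℝ ↦ (t : ℂ) ^ (w - 1) • (h : ℝ → ℂ) t) =ᵐ[volume.restrict (Ioi 0)]
      fun t ↦ (Ioo (0 : ℝ) 1).indicator (fun t : ℝ ↦ c * (t : ℂ) ^ (w - 1)) t +
        (t : ℂ) ^ (w - 1) • (h₁ : ℝ → ℂ) t := by
  have hne1 : ∀ᵐ x : ℝ, x ≠ (1 : ℝ) := by
    have : (volume : Measure ℝ) {1} = 0 := measure_singleton 1
    filter_upwards [measure_eq_zero_iff_ae_notMem.1 this] with u hu
    simpa using hu
  filter_upwards [ae_restrict_mem measurableSet_Ioi, ae_restrict_of_ae (s := Ioi 0) hh₁,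
    ae_restrict_of_ae (s := Ioi 0) hc, ae_restrict_of_ae (s := Ioi 0) hne1] with x hx hgx hfx hxa
  have hx' : (0 : ℝ) < x := hx
  by_cases hlt : x < 1
  · rw [Set.indicator_of_mem (show x ∈ Ioo (0 : ℝ) 1 from ⟨hx', hlt⟩), hgx, Set.indicator_of_notMem,
      hfx ⟨hx', hlt⟩, smul_eq_mul, smul_zero, add_zero, mul_comm]
    simp only [mem_setOf_eq, not_lt, abs_of_pos hx']
    exact hlt.le
  · have h' : 1 < x := lt_of_le_of_ne (not_lt.1 hlt) (Ne.symm hxa)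
    rw [Set.indicator_of_notMem (fun hm : x ∈ Ioo (0 : ℝ) 1 ↦ hlt hm.2), zero_add, hgx,
      Set.indicator_of_mem]
    simp only [mem_setOf_eq, abs_of_pos hx']
    exact h'

/-- `c·t^{w−1}` is integrable on `(0,1)` for `Re w > 0`. [folklore] -/
private theorem integrableOn_const_mul_cpow_Ioo (c : ℂ) {w : ℂ} (hw0 : 0 < w.re) :
    IntegrableOn (fun t : ℝ ↦ c * (t : ℂ) ^ (w - 1)) (Ioo 0 1) := by
  have hw1 : -1 < (w - 1).re := by simp; linarith
  have hIoc : IntegrableOn (fun t : ℝ ↦ (t : ℂ) ^ (w - 1)) (Ioc 0 1) :=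
    (intervalIntegral.intervalIntegrable_cpow' (a := 0) (b := 1) hw1).1
  exact (hIoc.mono_set Ioo_subset_Ioc_self).const_mul c

include hh₁ in
/-- **Absolute convergence on the strip**: for `h ∈ L²` with `h = c` a.e. on `(0,1)`, `t^{w−1}h(t)` is
integrable on `(0,∞)` for `0 < Re w < 1/2` (i.e. `ĥ(s)` converges absolutely for `1/2 < Re s < 1`).
[cite: Burnol2004b, §1 (arXiv:math/0203120v7 p. 4, TeX l.350–355)] -/
theorem integrableOn_cpow_smul {c : ℂ} (hc : ∀ᵐ x : ℝ, x ∈ Ioo (0 : ℝ) 1 → h x = c)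
    {w : ℂ} (hw0 : 0 < w.re) (hw : w.re < 1 / 2) :
    IntegrableOn (fun t : ℝ ↦ (t : ℂ) ^ (w - 1) • (h : ℝ → ℂ) t) (Ioi 0) := by
  have hI1 := integrableOn_const_mul_cpow_Ioo c hw0
  have hI2 := integrableOn_cpow_smul_trunc h h₁ hh₁ hw
  exact (((hI1.integrable_indicator measurableSet_Ioo).integrableOn (s := Ioi 0)).add hI2).congr_fun_ae
    (cpow_smul_ae_eq_decomp h h₁ hh₁ hc w).symm

include hh₁ in
/-- **Strip decomposition** (`a = 1`): for `0 < Re w < 1/2` and `h = c` a.e. on `(0,1)`,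
`∫_0^∞ h(t)t^{w−1}dt = c/w + ∫_0^∞ (𝟙_{t>1}h)(t)t^{w−1}dt`.
[cite: Burnol2004, proof of Thm. 6.10 (TeX l.2436–2441); Burnol2004b, proof of Prop. 5.4 (TeX l.1166–1170)] -/
theorem mellin_eq_const_div_add_mellin_trunc {c : ℂ} (hc : ∀ᵐ x : ℝ, x ∈ Ioo (0 : ℝ) 1 → h x = c)
    {w : ℂ} (hw0 : 0 < w.re) (hw : w.re < 1 / 2) :
    mellin (h : ℝ → ℂ) w = c / w + mellin (h₁ : ℝ → ℂ) w := by
  have hw1 : -1 < (w - 1).re := by simp; linarith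
  have hwne : w ≠ 0 := fun h0 ↦ by simp [h0] at hw0
  have hI1 := integrableOn_const_mul_cpow_Ioo c hw0
  have hI2 := integrableOn_cpow_smul_trunc h h₁ hh₁ hw
  rw [mellin, integral_congr_ae (cpow_smul_ae_eq_decomp h h₁ hh₁ hc w),
    integral_add ((hI1.integrable_indicator measurableSet_Ioo).integrableOn (s := Ioi 0)) hI2,
    MeasureTheory.integral_indicator measurableSet_Ioo, mellin]
  congr 1
  rw [Measure.restrict_restrict measurableSet_Ioo,
    show Ioo (0 : ℝ) 1 ∩ Ioi 0 = Ioo 0 1 from inter_eq_left.2 Ioo_subset_Ioi_self,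
    MeasureTheory.integral_const_mul,
    ← integral_Ioc_eq_integral_Ioo, ← intervalIntegral.integral_of_le zero_le_one,
    integral_cpow (Or.inl hw1), sub_add_cancel, Complex.ofReal_zero, Complex.zero_cpow hwne, sub_zero,
    Complex.ofReal_one, Complex.one_cpow, ← mul_div_assoc, mul_one]

/-- The punctured half-plane `{Re s > 1/2} ∖ {1}` is preconnected (union of four convex pieces).
[folklore] -/
private theorem isPreconnected_halfPlane_diff_one :
    IsPreconnected ({s : ℂ | 1 / 2 < s.re} \ {1}) := by
  set P₁ : Set ℂ := {z | 1 / 2 < z.re} ∩ {z | 0 < z.im}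
  set P₂ : Set ℂ := {z | 1 / 2 < z.re} ∩ {z | z.im < 0}
  set P₃ : Set ℂ := {z | 1 / 2 < z.re} ∩ {z | z.re < 1}
  set P₄ : Set ℂ := {z : ℂ | 1 < z.re}
  have c₁ : IsPreconnected P₁ := ((convex_halfSpace_re_gt _).inter (convex_halfSpace_im_gt _)).isPreconnected
  have c₂ : IsPreconnected P₂ := ((convex_halfSpace_re_gt _).inter (convex_halfSpace_im_lt _)).isPreconnected
  have c₃ : IsPreconnected P₃ := ((convex_halfSpace_re_gt _).inter (convex_halfSpace_re_lt _)).isPreconnected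
  have c₄ : IsPreconnected P₄ := (convex_halfSpace_re_gt _).isPreconnected
  have u₁ : IsPreconnected (P₁ ∪ P₃) :=
    IsPreconnected.union (3 / 4 + I) (by norm_num [P₁]) (by norm_num [P₃]) c₁ c₃
  have u₂ : IsPreconnected ((P₁ ∪ P₃) ∪ P₂) :=
    IsPreconnected.union (3 / 4 - I) (Or.inr (by norm_num [P₃])) (by norm_num [P₂]) u₁ c₂
  have u₃ : IsPreconnected (((P₁ ∪ P₃) ∪ P₂) ∪ P₄) :=
    IsPreconnected.union (2 + I) (Or.inl (Or.inl (by norm_num [P₁]))) (by norm_num [P₄]) u₂ c₄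
  have heq : ({s : ℂ | 1 / 2 < s.re} \ {1}) = ((P₁ ∪ P₃) ∪ P₂) ∪ P₄ := by
    ext z
    simp only [Set.mem_sdiff, mem_setOf_eq, mem_singleton_iff, mem_union, mem_inter_iff, P₁, P₂, P₃, P₄]
    constructor
    · rintro ⟨hre, hne⟩
      rcases lt_trichotomy z.im 0 with him | him | him
      · exact Or.inl (Or.inr ⟨hre, him⟩)
      · rcases lt_trichotomy z.re 1 with hr | hr | hr
        · exact Or.inl (Or.inl (Or.inr ⟨hre, hr⟩))
        · exact absurd (Complex.ext (by simpa using hr) (by simpa using him)) hne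
        · exact Or.inr hr
      · exact Or.inl (Or.inl (Or.inl ⟨hre, him⟩))
    · rintro (((⟨hre, him⟩ | ⟨hre, hr⟩) | ⟨hre, him⟩) | hr)
      · exact ⟨hre, fun h1 ↦ by subst h1; simp at him⟩
      · exact ⟨hre, fun h1 ↦ by subst h1; simp at hr⟩
      · exact ⟨hre, fun h1 ↦ by subst h1; simp at him⟩
      · exact ⟨by linarith, fun h1 ↦ by subst h1; simp at hr⟩
  rw [heq]
  exact u₃

include hh₁ in
/-- `s ↦ ∫_1^∞ h(t)t^{−s}dt = ∫_0^∞ (𝟙_{t>1}h)(t) t^{(1−s)−1}dt` is holomorphic on `Re s > 1/2`.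
[cite: Burnol2001CRAS, §1 (TeX l.288–290)] -/
theorem differentiableOn_mellin_trunc_one_sub :
    DifferentiableOn ℂ (fun s : ℂ ↦ mellin (h₁ : ℝ → ℂ) (1 - s)) {s : ℂ | 1 / 2 < s.re} := by
  intro z hz
  have hd := Literature.Analysis.DeBrangesSpaces.SonineMellin.differentiableOn_mellin one_pos h₁
    (trunc_ae_zero h h₁ hh₁)
  have hz' : (1 - z).re < 1 / 2 := by simp at hz ⊢; linarith
  exact ((hd (1 - z) hz').differentiableAt ((isOpen_lt Complex.continuous_re continuous_const).mem_nhds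
    hz')).comp z ((differentiableAt_const _).sub differentiableAt_id) |>.differentiableWithinAt

include hh₁ in
/-- **The continuation on the right half-plane**: for `h ∈ L_1` with `h = c` a.e. on `(0,1)`,
`G_h(s) = c/(1−s) + ∫_1^∞ h(t)t^{−s}dt` for all `Re s > 1/2`, `s ≠ 1` (identity theorem from the strip
`1/2 < Re s < 1`, where both sides are `ĥ(s)`). In particular `Res_{s=1} G_h = −c`.
[cite: Burnol2004b, proof of Prop. 5.4 (arXiv:math/0203120v7 p. 14, TeX l.1166–1172)] -/
theorem rightMellinExt_eq_of_half_lt_re (hh : h ∈ sonineL 1) {c : ℂ}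
    (hc : ∀ᵐ x : ℝ, x ∈ Ioo (0 : ℝ) 1 → h x = c) {s : ℂ} (hs : 1 / 2 < s.re) (hs1 : s ≠ 1) :
    rightMellinExt h s = c / (1 - s) + mellin (h₁ : ℝ → ℂ) (1 - s) := by
  set V : Set ℂ := {s : ℂ | 1 / 2 < s.re} \ {1}
  have hVo : IsOpen V := (isOpen_lt continuous_const Complex.continuous_re).sdiff isClosed_singleton
  have hG : AnalyticOnNhd ℂ (rightMellinExt h) V :=
    ((hasRightMellinContinuation_rightMellinExt_of_mem_sonineL one_pos hh).1.mono
      (fun z hz ↦ hz.2)).analyticOnNhd hVo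
  have hM := differentiableOn_mellin_trunc_one_sub h h₁ hh₁
  have hR : AnalyticOnNhd ℂ (fun s : ℂ ↦ c / (1 - s) + mellin (h₁ : ℝ → ℂ) (1 - s)) V := by
    refine DifferentiableOn.analyticOnNhd (fun z hz ↦ ?_) hVo
    refine DifferentiableWithinAt.add ?_ ((hM z hz.1).mono fun w hw ↦ hw.1)
    exact ((differentiableAt_const c).div ((differentiableAt_const _).sub differentiableAt_id)
      (sub_ne_zero.2 (Ne.symm hz.2))).differentiableWithinAt
  have h34 : (3 / 4 : ℂ) ∈ V := by
    refine ⟨by norm_num, ?_⟩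
    simp only [mem_singleton_iff]
    intro h'
    have := congrArg Complex.re h'
    norm_num at this
  have hev : rightMellinExt h =ᶠ[𝓝 (3 / 4 : ℂ)] fun s ↦ c / (1 - s) + mellin (h₁ : ℝ → ℂ) (1 - s) := by
    have hstrip : IsOpen {s : ℂ | 1 / 2 < s.re ∧ s.re < 1} :=
      (isOpen_lt continuous_const Complex.continuous_re).inter (isOpen_lt Complex.continuous_re continuous_const)
    have hmem : (3 / 4 : ℂ) ∈ {s : ℂ | 1 / 2 < s.re ∧ s.re < 1} := by simp; norm_num
    filter_upwards [hstrip.mem_nhds hmem] with z hz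
    rw [(hasRightMellinContinuation_rightMellinExt_of_mem_sonineL one_pos hh).2 z hz.1 hz.2, rightMellin,
      mellin_eq_const_div_add_mellin_trunc h h₁ hh₁ hc (by simp; linarith [hz.2]) (by simp; linarith [hz.1])]
  exact hG.eqOn_of_preconnected_of_eventuallyEq hR isPreconnected_halfPlane_diff_one h34 hev ⟨hs, hs1⟩

include hh₁ in
/-- The function `(−c + (s−1)∫_1^∞ h t^{−s})/ζ₁(s)` (`ζ₁(s) = (s−1)ζ(s)`, Mathlib's `riemannZeta₁`,
`ζ₁(1) = 1`) is analytic at `s = 1`. [folklore] -/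
private theorem analyticAt_numerator_div_zeta₁ (c : ℂ) :
    AnalyticAt ℂ (fun s ↦ (-c + (s - 1) * mellin (h₁ : ℝ → ℂ) (1 - s)) / riemannZeta₁ s) 1 := by
  have hO : IsOpen ({s : ℂ | 1 / 2 < s.re} ∩ {s | riemannZeta₁ s ≠ 0}) :=
    (isOpen_lt continuous_const Complex.continuous_re).inter
      (isOpen_ne_fun differentiable_riemannZeta₁.continuous continuous_const)
  have h1 : (1 : ℂ) ∈ {s : ℂ | 1 / 2 < s.re} ∩ {s | riemannZeta₁ s ≠ 0} :=
    ⟨by norm_num, by simp [riemannZeta₁_one]⟩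
  have hM := differentiableOn_mellin_trunc_one_sub h h₁ hh₁
  have hd : DifferentiableOn ℂ (fun s ↦ (-c + (s - 1) * mellin (h₁ : ℝ → ℂ) (1 - s)) / riemannZeta₁ s)
      ({s : ℂ | 1 / 2 < s.re} ∩ {s | riemannZeta₁ s ≠ 0}) := by
    intro z hz
    refine DifferentiableWithinAt.div ?_
      (differentiable_riemannZeta₁ z).differentiableWithinAt hz.2
    exact ((differentiableAt_const _).add (((differentiableAt_id).sub (differentiableAt_const _)).mul
      ((hM z hz.1).differentiableAt ((isOpen_lt continuous_const Complex.continuous_re).mem_nhds hz.1))))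
      |>.differentiableWithinAt
  exact hd.analyticAt (hO.mem_nhds h1)

include hh₁ in
/-- **`s = 1` is not a singularity of `G_h(s)/ζ(s)`**: on a punctured neighbourhood of `1`,
`G_h(s)/ζ(s) = (−c + (s−1)∫_1^∞ h t^{−s})/ζ₁(s)` (the simple pole of `G_h` against the simple zero of
`1/ζ`): "We note that the trivial zeros and `s = 1` are not singularities and contribute no residue."
[cite: Burnol2004b, §5 after Thm. 5.2 (arXiv:math/0203120v7 p. 12, TeX l.1007–1010)] -/
theorem div_zeta_eventuallyEq_near_one (hh : h ∈ sonineL 1) {c : ℂ}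
    (hc : ∀ᵐ x : ℝ, x ∈ Ioo (0 : ℝ) 1 → h x = c) :
    (fun s ↦ rightMellinExt h s / riemannZeta s) =ᶠ[𝓝[≠] (1 : ℂ)]
      fun s ↦ (-c + (s - 1) * mellin (h₁ : ℝ → ℂ) (1 - s)) / riemannZeta₁ s := by
  have hO : IsOpen {s : ℂ | 1 / 2 < s.re} := isOpen_lt continuous_const Complex.continuous_re
  have h1 : (1 : ℂ) ∈ {s : ℂ | 1 / 2 < s.re} := by simp only [mem_setOf_eq, one_re]; norm_num
  filter_upwards [self_mem_nhdsWithin, mem_nhdsWithin_of_mem_nhds (hO.mem_nhds h1)] with s hs hs'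
  rw [rightMellinExt_eq_of_half_lt_re h h₁ hh₁ hh hc hs' hs, riemannZeta_eq_inv_sub_mul hs, ← div_div,
    div_inv_eq_mul]
  congr 1
  have hs1' : (1 : ℂ) - s ≠ 0 := sub_ne_zero.2 (Ne.symm hs)
  field_simp
  ring

end Strip

/-! ### `1/ζ` on `Re s = 2`: the Möbius series, term by term -/

/-- `1/ζ(s) = Σ_{k≥1} μ(k) k^{−s}` for `Re s > 1` (Mathlib's `LSeries` of the Möbius function).
[folklore] -/
private theorem inv_zeta_eq_LSeries_moebius {s : ℂ} (hs : 1 < s.re) :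
    (riemannZeta s)⁻¹ = LSeries (fun n : ℕ ↦ ((ArithmeticFunction.moebius n : ℤ) : ℂ)) s := by
  have h := LSeries_one_mul_Lseries_moebius hs
  rw [LSeries_one_eq_riemannZeta hs] at h
  exact inv_eq_of_mul_eq_one_right h

/-- `‖μ(k) k^{−s}‖ ≤ k^{−Re s}` (and `0` for `k = 0`). [folklore] -/
private theorem norm_term_moebius_le (s : ℂ) (k : ℕ) :
    ‖LSeries.term (fun n : ℕ ↦ ((ArithmeticFunction.moebius n : ℤ) : ℂ)) s k‖ ≤
      if k = 0 then 0 else (k : ℝ) ^ (-s.re) := by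
  rw [LSeries.norm_term_eq]
  split_ifs with hk
  · exact le_rfl
  · have h1 : ‖((ArithmeticFunction.moebius k : ℤ) : ℂ)‖ ≤ 1 := by
      rw [Complex.norm_intCast]
      exact_mod_cast ArithmeticFunction.abs_moebius_le_one
    have hk0 : (0 : ℝ) < k := Nat.cast_pos.2 (Nat.pos_of_ne_zero hk)
    calc ‖((ArithmeticFunction.moebius k : ℤ) : ℂ)‖ / (k : ℝ) ^ s.re ≤ 1 / (k : ℝ) ^ s.re := by
          gcongr
      _ = (k : ℝ) ^ (-s.re) := by rw [Real.rpow_neg hk0.le, one_div]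

/-- **Term-by-term integration against `1/ζ` on `Re s = 2`.** If `y ↦ Φ(2+iy)` is continuous and
integrable and `∫ Φ(2+iy) k^{−(2+iy)} dy = 0` for every `k ≥ 1`, then `∫ Φ(2+iy)/ζ(2+iy) dy = 0`
("Using on `σ = 2` the absolutely convergent expression `1/ζ(s) = Σ_{k≥1} μ(k)k^{−s}` it will be enough
to prove `0 = (1/2π)∫_{σ=2} G(s)k^{−s}|ds|`"). [cite: Burnol2004b, proof of Prop. 5.4 (arXiv:math/0203120v7 p. 14, TeX l.1155–1159)] -/
theorem integral_div_zeta_line_two_eq_zero {Φ : ℂ → ℂ} (hc : Continuous fun y : ℝ ↦ Φ (2 + y * I))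
    (hi : Integrable fun y : ℝ ↦ Φ (2 + y * I))
    (hk : ∀ k : ℕ, 1 ≤ k → ∫ y : ℝ, Φ (2 + y * I) * (k : ℂ) ^ (-(2 + y * I)) = 0) :
    ∫ y : ℝ, Φ (2 + y * I) / riemannZeta (2 + y * I) = 0 := by
  set μc : ℕ → ℂ := fun n : ℕ ↦ ((ArithmeticFunction.moebius n : ℤ) : ℂ) with hμc
  have hre : ∀ y : ℝ, 1 < ((2 : ℂ) + y * I).re := fun y ↦ by simp
  -- pointwise expansion
  have hpt : ∀ y : ℝ, Φ (2 + y * I) / riemannZeta (2 + y * I) =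
      ∑' k : ℕ, Φ (2 + y * I) * LSeries.term μc (2 + y * I) k := by
    intro y
    rw [div_eq_mul_inv, inv_zeta_eq_LSeries_moebius (hre y), LSeries, ← tsum_mul_left]
  simp_rw [hpt]
  -- the summands
  set F : ℕ → ℝ → ℂ := fun k y ↦ Φ (2 + y * I) * LSeries.term μc (2 + y * I) k with hF
  have hterm_cont : ∀ k, Continuous fun y : ℝ ↦ LSeries.term μc (2 + y * I) k := by
    intro k
    rcases eq_or_ne k 0 with rfl | hk0
    · simp only [LSeries.term_zero]; exact continuous_const
    · have hk0' : (k : ℂ) ≠ 0 := by exact_mod_cast hk0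
      simp only [LSeries.term_of_ne_zero hk0]
      refine continuous_const.div (Continuous.const_cpow (by fun_prop) (Or.inl hk0')) fun y ↦ ?_
      rw [Ne, cpow_eq_zero_iff, not_and_or]
      exact Or.inl hk0'
  have hbound : ∀ k y, ‖F k y‖ ≤ (if k = 0 then 0 else (k : ℝ) ^ (-(2 : ℝ))) * ‖Φ (2 + y * I)‖ := by
    intro k y
    rw [hF]
    simp only [norm_mul]
    rw [mul_comm]
    gcongr
    simpa using norm_term_moebius_le (2 + y * I) k
  have hint : ∀ k, Integrable (F k) := by
    intro k
    refine Integrable.mono' (hi.norm.const_mul (if k = 0 then 0 else (k : ℝ) ^ (-(2 : ℝ))))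
      ((hc.mul (hterm_cont k)).aestronglyMeasurable) (Eventually.of_forall fun y ↦ ?_)
    exact hbound k y
  have hI0 : 0 ≤ ∫ y : ℝ, ‖Φ (2 + y * I)‖ := integral_nonneg fun y ↦ norm_nonneg _
  have hsum : Summable fun k ↦ ∫ y, ‖F k y‖ := by
    have hmaj : Summable fun k : ℕ ↦ (k : ℝ) ^ (-(2 : ℝ)) * ∫ y : ℝ, ‖Φ (2 + y * I)‖ :=
      (Real.summable_nat_rpow.2 (by norm_num)).mul_right _
    refine Summable.of_nonneg_of_le (fun k ↦ integral_nonneg fun y ↦ norm_nonneg _) (fun k ↦ ?_) hmaj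
    have hk' : (if k = 0 then 0 else (k : ℝ) ^ (-(2 : ℝ))) ≤ (k : ℝ) ^ (-(2 : ℝ)) := by
      split_ifs
      · exact Real.rpow_nonneg (Nat.cast_nonneg k) _
      · exact le_rfl
    calc ∫ y, ‖F k y‖ ≤ ∫ y : ℝ, (if k = 0 then 0 else (k : ℝ) ^ (-(2 : ℝ))) * ‖Φ (2 + y * I)‖ :=
          integral_mono_of_nonneg (Eventually.of_forall fun y ↦ norm_nonneg _)
            (hi.norm.const_mul _) (Eventually.of_forall fun y ↦ hbound k y)
      _ = (if k = 0 then 0 else (k : ℝ) ^ (-(2 : ℝ))) * ∫ y : ℝ, ‖Φ (2 + y * I)‖ :=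
          MeasureTheory.integral_const_mul _ _
      _ ≤ (k : ℝ) ^ (-(2 : ℝ)) * ∫ y : ℝ, ‖Φ (2 + y * I)‖ := mul_le_mul_of_nonneg_right hk' hI0
  rw [← integral_tsum_of_summable_integral_norm hint hsum]
  -- each term vanishes
  have hzero : ∀ k, ∫ y, F k y = 0 := by
    intro k
    rcases eq_or_ne k 0 with rfl | hk0
    · simp [hF, LSeries.term]
    · have hk1 : 1 ≤ k := Nat.one_le_iff_ne_zero.2 hk0
      have heq : ∀ y : ℝ, F k y = μc k * (Φ (2 + y * I) * (k : ℂ) ^ (-(2 + y * I))) := by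
        intro y
        simp only [hF, LSeries.term_of_ne_zero hk0, cpow_neg, div_eq_mul_inv]
        ring
      simp_rw [heq]
      rw [MeasureTheory.integral_const_mul, hk k hk1, mul_zero]
  simp [hzero]

/-! ### The `σ = −1` line and the functional equations -/

/-- **`G(s)/ζ(s) = H(1−s)/ζ(1−s)` on `Re s = −1`**, `H = G_{𝓕g}`: the functional equations
`Λ(1−s) = Λ(s)` of `ζ` (Mathlib) and `Γ_ℝ(s)G_{𝓕g}(s) = Γ_ℝ(1−s)G_g(1−s)` of the Sonine space `L_1`
(Prop. 2.2 (v)) — "the `σ = −1` integral will then too also from the functional equation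
`G(1−s)/ζ(1−s) = 𝓕₊(G)(s)/ζ(s)`". [cite: Burnol2004b, proof of Prop. 5.4 (arXiv:math/0203120v7 p. 14, TeX l.1150–1154)] -/
theorem div_zeta_neg_one_line {g : Lp ℂ 2 (volume : Measure ℝ)} (hg : g ∈ sonineL 1) (t : ℝ) :
    rightMellinExt g (-1 + t * I) / riemannZeta (-1 + t * I) =
      rightMellinExt (𝓕 g : Lp ℂ 2 (volume : Measure ℝ)) (2 + ((-t : ℝ) : ℂ) * I) /
        riemannZeta (2 + ((-t : ℝ) : ℂ) * I) := by
  set s : ℂ := -1 + t * I with hsdef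
  set u : ℂ := 2 + ((-t : ℝ) : ℂ) * I with hudef
  have hus : 1 - u = s := by rw [hsdef, hudef]; push_cast; ring
  have hsu : 1 - s = u := by rw [← hus]; ring
  have hu0 : ∀ n : ℕ, u ≠ -2 * (n : ℂ) := by
    intro n h
    have := congrArg Complex.re h
    simp [hudef] at this
    have : (0 : ℝ) ≤ n := n.cast_nonneg
    linarith
  have hu1 : ∀ n : ℕ, u ≠ 1 + 2 * (n : ℂ) := by
    intro n h
    have := congrArg Complex.re h
    simp [hudef] at this
    have h2 : (2 : ℝ) = 1 + 2 * n := this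
    have h3 : (2 * n : ℝ) = 1 := by linarith
    norm_cast at h3
    omega
  have hFE := SonineLContinuation.rightMellinExt_functionalEquation_of_mem_sonineL one_pos hg u hu0 hu1
  rw [hus] at hFE
  have hs0 : s ≠ 0 := fun h ↦ by simpa [hsdef] using congrArg Complex.re h
  have hu0' : u ≠ 0 := fun h ↦ by simpa [hudef] using congrArg Complex.re h
  have hΛ : completedRiemannZeta s = completedRiemannZeta u := by
    rw [← hus]; exact completedRiemannZeta_one_sub u
  rw [riemannZeta_def_of_ne_zero hs0, riemannZeta_def_of_ne_zero hu0', div_div_eq_mul_div,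
    div_div_eq_mul_div, hΛ, mul_comm (rightMellinExt (𝓕 g : Lp ℂ 2 (volume : Measure ℝ)) u), hFE,
    mul_comm]

/-- **Decay of `H = G_{𝓕g}` on `1/2 < σ′ ≤ Re u ≤ 2` from the decay of `G` on `−1 ≤ Re ≤ 1 − σ′`**
(`g ∈ 𝓛₁`): `‖H(u)‖ ≤ C/(Im u)²` for `|Im u| ≥ 1`. Through the functional equation
`H(u) = Γ_ℝ(1−u)G(1−u)/Γ_ℝ(u)` and Stirling's vertical ratio bound
`|Γ((1−u)/2)| ≤ C|Im u/2|^{1/2−Re u}|Γ(u/2)|` ("Clear from the estimates of `χ(s)` in vertical strips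
([Titchmarsh, IV.12.3])" — the part of Lemma 4.10 that Prop. 5.4 uses).
[cite: Burnol2004b, Lemma 4.10 and proof of Prop. 5.4 (arXiv:math/0203120v7 pp. 11, 14, TeX l.947–951, 1150–1154)] -/
theorem exists_fourier_strip_decay {g : Lp ℂ 2 (volume : Measure ℝ)} (hg : g ∈ burnolScriptL1)
    {σ' : ℝ} (hσ : 1 / 2 < σ') :
    ∃ C : ℝ, ∀ u : ℂ, σ' ≤ u.re → u.re ≤ 2 → 1 ≤ |u.im| →
      ‖rightMellinExt (𝓕 g : Lp ℂ 2 (volume : Measure ℝ)) u‖ ≤ C / u.im ^ 2 := by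
  set H : ℂ → ℂ := rightMellinExt (𝓕 g : Lp ℂ 2 (volume : Measure ℝ)) with hH
  have hFg : (𝓕 g : Lp ℂ 2 (volume : Measure ℝ)) ∈ sonineL 1 := fourier_mem_sonineL hg.1
  -- (1) the large-height part, `|Im u| ≥ 2`
  obtain ⟨C₁, hC₁⟩ := hg.2 (-1) (1 - σ') 2
  obtain ⟨C₂, hC₂pos, hC₂⟩ :=
    Literature.Analysis.SpecialFunctions.GammaStirling.exists_norm_Gamma_vertical_ratio_le (-1 / 2 : ℝ) 1
  have hlarge : ∀ u : ℂ, σ' ≤ u.re → u.re ≤ 2 → 2 ≤ |u.im| →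
      ‖H u‖ ≤ (π ^ (3 / 2 : ℝ) * C₂ * max C₁ 0) / u.im ^ 2 := by
    intro u hu1 hu2 hui
    have hure : 0 < u.re := by linarith
    have hΓu : Gammaℝ u ≠ 0 := Gammaℝ_ne_zero_of_re_pos hure
    have hu0 : ∀ n : ℕ, u ≠ -2 * (n : ℂ) := by
      intro n h0
      have := congrArg Complex.re h0
      simp at this
      have : (0 : ℝ) ≤ n := n.cast_nonneg
      linarith
    have hu1' : ∀ n : ℕ, u ≠ 1 + 2 * (n : ℂ) := by
      intro n h0
      have := congrArg Complex.im h0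
      simp at this
      rw [this, abs_zero] at hui
      linarith
    have hFE := SonineLContinuation.rightMellinExt_functionalEquation_of_mem_sonineL one_pos hg.1 u hu0 hu1'
    have hHu : H u = Gammaℝ (1 - u) * rightMellinExt g (1 - u) / Gammaℝ u := by
      rw [hH, eq_div_iff hΓu, mul_comm, hFE]
    -- the decay of `G` at `1 - u`
    have hG : ‖rightMellinExt g (1 - u)‖ ≤ max C₁ 0 / u.im ^ 2 := by
      have h := hC₁ (1 - u) (by simp; linarith) (by simp; linarith) (by simpa using by linarith)
      have hui0 : 0 < |u.im| := by linarith
      have hn : |u.im| ≤ ‖1 - u‖ := by simpa using abs_im_le_norm (1 - u)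
      have hpow : ‖1 - u‖ ^ (-((2 : ℕ) : ℝ)) ≤ |u.im| ^ (-((2 : ℕ) : ℝ)) :=
        Real.rpow_le_rpow_of_nonpos hui0 hn (by norm_num)
      calc ‖rightMellinExt g (1 - u)‖ ≤ C₁ * ‖1 - u‖ ^ (-((2 : ℕ) : ℝ)) := h
        _ ≤ max C₁ 0 * ‖1 - u‖ ^ (-((2 : ℕ) : ℝ)) := by gcongr; exact le_max_left _ _
        _ ≤ max C₁ 0 * |u.im| ^ (-((2 : ℕ) : ℝ)) :=
            mul_le_mul_of_nonneg_left hpow (le_max_right _ _)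
        _ = max C₁ 0 / u.im ^ 2 := by
            rw [Real.rpow_neg (abs_nonneg _), show ((2 : ℕ) : ℝ) = (2 : ℕ) by norm_num,
              Real.rpow_natCast, sq_abs, div_eq_mul_inv]
    -- the Gamma ratio
    have hratio : ‖Gammaℝ (1 - u)‖ ≤ π ^ (3 / 2 : ℝ) * C₂ * ‖Gammaℝ u‖ := by
      have hx₁ : (1 - u.re) / 2 ∈ Icc (-1 / 2 : ℝ) 1 := ⟨by linarith, by linarith⟩
      have hx₂ : u.re / 2 ∈ Icc (-1 / 2 : ℝ) 1 := ⟨by linarith, by linarith⟩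
      have hv : 1 ≤ |u.im / 2| := by rw [abs_div, abs_two]; linarith
      have hΓ := hC₂ _ hx₁ _ hx₂ (u.im / 2) hv
      -- `|v|^{x₁ - x₂} ≤ 1`
      have hexp : |u.im / 2| ^ ((1 - u.re) / 2 - u.re / 2) ≤ 1 :=
        Real.rpow_le_one_of_one_le_of_nonpos hv (by linarith)
      have hΓ' : ‖Complex.Gamma ((((1 - u.re) / 2 : ℝ) : ℂ) + (u.im / 2 : ℝ) * I)‖ ≤
          C₂ * ‖Complex.Gamma (((u.re / 2 : ℝ) : ℂ) + (u.im / 2 : ℝ) * I)‖ := by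
        calc _ ≤ C₂ * |u.im / 2| ^ ((1 - u.re) / 2 - u.re / 2) *
              ‖Complex.Gamma (((u.re / 2 : ℝ) : ℂ) + (u.im / 2 : ℝ) * I)‖ := hΓ
          _ ≤ C₂ * 1 * ‖Complex.Gamma (((u.re / 2 : ℝ) : ℂ) + (u.im / 2 : ℝ) * I)‖ := by
              gcongr
          _ = _ := by rw [mul_one]
      -- identify the Gamma factors of `Γ_ℝ(1 − u)` and `Γ_ℝ(u)`
      have e1 : (1 - u) / 2 = starRingEnd ℂ ((((1 - u.re) / 2 : ℝ) : ℂ) + (u.im / 2 : ℝ) * I) := by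
        rw [map_add, map_mul, Complex.conj_ofReal, Complex.conj_ofReal, Complex.conj_I]
        apply Complex.ext
        · simp
        · simp; ring
      have e2 : u / 2 = (((u.re / 2 : ℝ) : ℂ) + (u.im / 2 : ℝ) * I) := by
        apply Complex.ext <;> simp
      have n1 : ‖Complex.Gamma ((1 - u) / 2)‖ =
          ‖Complex.Gamma ((((1 - u.re) / 2 : ℝ) : ℂ) + (u.im / 2 : ℝ) * I)‖ := by
        rw [e1, Complex.Gamma_conj, RCLike.norm_conj]
      have n2 : ‖Complex.Gamma (u / 2)‖ = ‖Complex.Gamma (((u.re / 2 : ℝ) : ℂ) + (u.im / 2 : ℝ) * I)‖ := by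
        rw [e2]
      -- the powers of `π`
      have p1 : ‖(π : ℂ) ^ (-(1 - u) / 2)‖ = π ^ (-(1 - u.re) / 2) := by
        rw [Complex.norm_cpow_eq_rpow_re_of_pos Real.pi_pos]; congr 1; simp
      have p2 : ‖(π : ℂ) ^ (-u / 2)‖ = π ^ (-u.re / 2) := by
        rw [Complex.norm_cpow_eq_rpow_re_of_pos Real.pi_pos]; congr 1; simp
      have ppi : π ^ (-(1 - u.re) / 2) ≤ π ^ (3 / 2 : ℝ) * π ^ (-u.re / 2) := by
        rw [← Real.rpow_add Real.pi_pos]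
        exact Real.rpow_le_rpow_of_exponent_le (by linarith [Real.pi_gt_three]) (by linarith)
      rw [Gammaℝ_def, Gammaℝ_def, norm_mul, norm_mul, p1, p2, n1, n2]
      calc π ^ (-(1 - u.re) / 2) * ‖Complex.Gamma ((((1 - u.re) / 2 : ℝ) : ℂ) + (u.im / 2 : ℝ) * I)‖
          ≤ (π ^ (3 / 2 : ℝ) * π ^ (-u.re / 2)) *
            (C₂ * ‖Complex.Gamma (((u.re / 2 : ℝ) : ℂ) + (u.im / 2 : ℝ) * I)‖) := by
            gcongr
        _ = π ^ (3 / 2 : ℝ) * C₂ *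
            (π ^ (-u.re / 2) * ‖Complex.Gamma (((u.re / 2 : ℝ) : ℂ) + (u.im / 2 : ℝ) * I)‖) := by ring
    -- assemble
    have hΓu' : 0 < ‖Gammaℝ u‖ := norm_pos_iff.2 hΓu
    rw [hHu, norm_div, norm_mul, div_le_iff₀ hΓu']
    calc ‖Gammaℝ (1 - u)‖ * ‖rightMellinExt g (1 - u)‖
        ≤ (π ^ (3 / 2 : ℝ) * C₂ * ‖Gammaℝ u‖) * (max C₁ 0 / u.im ^ 2) := by
          gcongr
      _ = π ^ (3 / 2 : ℝ) * C₂ * max C₁ 0 / u.im ^ 2 * ‖Gammaℝ u‖ := by ring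
  -- (2) the compact part, `1 ≤ |Im u| ≤ 2`
  have hcont : ContinuousOn H ((Icc σ' 2 ×ℂ Icc 1 2) ∪ (Icc σ' 2 ×ℂ Icc (-2) (-1))) := by
    intro u hu
    have hu1 : u ≠ 1 := by
      intro h1
      rcases hu with hu | hu
      · have := (Complex.mem_reProdIm.1 hu).2.1; rw [h1] at this; norm_num at this
      · have := (Complex.mem_reProdIm.1 hu).2.2; rw [h1] at this; norm_num at this
    exact (differentiableAt_rightMellinExt hFg hu1).continuousAt.continuousWithinAt
  have hK : IsCompact ((Icc σ' 2 ×ℂ Icc 1 2) ∪ (Icc σ' 2 ×ℂ Icc (-2) (-1))) :=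
    (isCompact_Icc.reProdIm isCompact_Icc).union (isCompact_Icc.reProdIm isCompact_Icc)
  obtain ⟨M, hM⟩ := hK.exists_bound_of_continuousOn hcont
  refine ⟨max (π ^ (3 / 2 : ℝ) * C₂ * max C₁ 0) (4 * max M 0), fun u hu1 hu2 hui ↦ ?_⟩
  have hui0 : 0 < u.im ^ 2 := by nlinarith [sq_abs u.im, abs_nonneg u.im]
  rcases le_or_gt 2 |u.im| with hbig | hsmall
  · exact (hlarge u hu1 hu2 hbig).trans (div_le_div_of_nonneg_right (le_max_left _ _) hui0.le)
  · have hmem : u ∈ (Icc σ' 2 ×ℂ Icc 1 2) ∪ (Icc σ' 2 ×ℂ Icc (-2) (-1)) := by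
      rcases le_or_gt 0 u.im with hp | hn
      · left
        rw [abs_of_nonneg hp] at hui hsmall
        exact Complex.mem_reProdIm.2 ⟨⟨hu1, hu2⟩, ⟨hui, hsmall.le⟩⟩
      · right
        rw [abs_of_neg hn] at hui hsmall
        exact Complex.mem_reProdIm.2 ⟨⟨hu1, hu2⟩, ⟨by linarith, by linarith⟩⟩
    have hb := hM u hmem
    have hsq : u.im ^ 2 ≤ 4 := by nlinarith [abs_nonneg u.im, sq_abs u.im]
    calc ‖H u‖ ≤ max M 0 := hb.trans (le_max_left _ _)
      _ ≤ 4 * max M 0 / u.im ^ 2 := by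
          rw [le_div_iff₀ hui0]; nlinarith [le_max_right M 0]
      _ ≤ _ := div_le_div_of_nonneg_right (le_max_right _ _) hui0.le


/-! ## §C. Lemma K: `∫_{Re s = 2} G(s) k^{−s} ds = 0` for `k ≥ 1` -/

section LemmaK

variable {h : Lp ℂ 2 (volume : Measure ℝ)} (hh : h ∈ sonineL 1) {c : ℂ}
  (hc : ∀ᵐ x : ℝ, x ∈ Ioo (0 : ℝ) 1 → h x = c)
  (h₁ : Lp ℂ 2 (volume : Measure ℝ)) (hh₁ : ∀ᵐ x : ℝ, h₁ x = Set.indicator {x : ℝ | 1 < |x|} (h : ℝ → ℂ) x)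
  {σ' : ℝ} (hσ : 1 / 2 < σ') (hσ1 : σ' < 1)
  (hdec : ∃ C : ℝ, ∀ u : ℂ, σ' ≤ u.re → u.re ≤ 2 → 1 ≤ |u.im| → ‖rightMellinExt h u‖ ≤ C / u.im ^ 2)

include hh hdec in
/-- Under the strip decay, `G_h` is integrable along every line `σ' ≤ σ ≤ 2`, `σ ≠ 1`. [folklore] -/
private theorem integrable_line_of_strip_decay {σ : ℝ} (h1 : σ' ≤ σ) (h2 : σ ≤ 2) (hσ1' : σ ≠ 1) :
    Integrable fun y : ℝ ↦ rightMellinExt h (σ + y * I) := by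
  obtain ⟨C, hC⟩ := hdec
  have hc' := continuous_rightMellinExt_line hh hσ1'
  obtain ⟨C', hC'⟩ := exists_norm_le_div_one_add_sq hc' (C := C) fun y hy ↦ by
    simpa using hC (σ + y * I) (by simpa using h1) (by simpa using h2) (by simpa using hy)
  exact integrable_of_norm_le_div_one_add_sq hc' hC'

/-- `‖k^{−s}‖ = k^{−Re s} ≤ 1` for `k ≥ 1`, `Re s ≥ 0`. [folklore] -/
private theorem norm_natCast_cpow_neg_le_one {k : ℕ} (hk : 1 ≤ k) {s : ℂ} (hs : 0 ≤ s.re) :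
    ‖(k : ℂ) ^ (-s)‖ ≤ 1 := by
  rw [Complex.norm_natCast_cpow_of_pos (by omega), neg_re]
  exact Real.rpow_le_one_of_one_le_of_nonpos (by exact_mod_cast hk) (by linarith)

include hh hσ hdec in
/-- Integrability of `G_h(σ+iy) k^{−(σ+iy)}` along a line `σ' ≤ σ ≤ 2`, `σ ≠ 1`. [folklore] -/
private theorem integrable_line_mul_cpow {σ : ℝ} (h1 : σ' ≤ σ) (h2 : σ ≤ 2) (hσ1' : σ ≠ 1) {k : ℕ} (hk : 1 ≤ k) :
    Integrable fun y : ℝ ↦ rightMellinExt h (σ + y * I) * (k : ℂ) ^ (-(σ + y * I)) := by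
  have hk0 : (k : ℂ) ≠ 0 := by exact_mod_cast (show k ≠ 0 by omega)
  refine (integrable_line_of_strip_decay hh hdec h1 h2 hσ1').mul_bdd (c := 1) ?_
    (Eventually.of_forall fun y ↦ ?_)
  · exact (Continuous.const_cpow (by fun_prop) (Or.inl hk0)).aestronglyMeasurable
  · exact norm_natCast_cpow_neg_le_one hk (by simp; linarith)

include hh hc hh₁ hσ hσ1 hdec in
/-- **The contour shift across the simple pole at `s = 1`**:
`i∫ G_h(2+iy)k^{−(2+iy)}dy − i∫ G_h(σ′+iy)k^{−(σ′+iy)}dy = 2πi·(−c/k)` ("We shift the integral … and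
obtain … `+ Res_1(G)/k`", `Res_1(G) = −c`). [cite: Burnol2004b, proof of Prop. 5.4 (arXiv:math/0203120v7 p. 14, TeX l.1159–1161, 1170–1172)] -/
theorem integral_line_two_sub_line_eq {k : ℕ} (hk : 1 ≤ k) :
    I * (∫ y : ℝ, rightMellinExt h (2 + y * I) * (k : ℂ) ^ (-(2 + y * I))) -
      I * (∫ y : ℝ, rightMellinExt h (σ' + y * I) * (k : ℂ) ^ (-(σ' + y * I))) =
      2 * Real.pi * I * (-(c / k)) := by
  have hk0 : (k : ℂ) ≠ 0 := by exact_mod_cast (show k ≠ 0 by omega)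
  obtain ⟨C₀, hC₀⟩ := hdec
  set G : ℂ → ℂ := rightMellinExt h with hGdef
  set M₁ : ℂ → ℂ := fun s ↦ mellin (h₁ : ℝ → ℂ) (1 - s) with hM₁
  set F : ℂ → ℂ := fun s ↦ G s * (k : ℂ) ^ (-s) with hFdef
  set ψ : ℂ → ℂ := fun z ↦ (-c + (z - 1) * M₁ z) * (k : ℂ) ^ (-z) with hψ
  set φ : ℂ → ℂ := fun z ↦ (z - 1) * ψ z with hφ
  have hO : IsOpen {s : ℂ | 1 / 2 < s.re} := isOpen_lt continuous_const Complex.continuous_re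
  have hM₁d : DifferentiableOn ℂ M₁ {s : ℂ | 1 / 2 < s.re} := differentiableOn_mellin_trunc_one_sub h h₁ hh₁
  have hcpow : Differentiable ℂ fun z : ℂ ↦ (k : ℂ) ^ (-z) :=
    differentiable_id.neg.const_cpow (Or.inl hk0)
  have hψd : DifferentiableOn ℂ ψ {s : ℂ | 1 / 2 < s.re} := by
    intro z hz
    exact (((differentiableAt_const _).add ((differentiableAt_id.sub (differentiableAt_const _)).mul
      ((hM₁d z hz).differentiableAt (hO.mem_nhds hz)))).mul (hcpow z)).differentiableWithinAt
  have hφd : DifferentiableOn ℂ φ {s : ℂ | 1 / 2 < s.re} := fun z hz ↦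
    ((differentiableAt_id.sub (differentiableAt_const _)).differentiableWithinAt).mul (hψd z hz)
  have hderiv : deriv φ 1 = -(c / k) := by
    have h1mem : {s : ℂ | 1 / 2 < s.re} ∈ 𝓝 (1 : ℂ) := hO.mem_nhds (by simp; norm_num)
    have hψ1 : DifferentiableAt ℂ ψ 1 := (hψd 1 (by simp; norm_num)).differentiableAt h1mem
    have hd : HasDerivAt φ (1 * ψ 1 + (1 - 1) * deriv ψ 1) 1 :=
      ((hasDerivAt_id (1 : ℂ)).sub_const 1).mul hψ1.hasDerivAt
    rw [hd.deriv]
    simp [hψ, cpow_neg, cpow_one, div_eq_mul_inv]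
  -- apply the strip residue theorem with the single pole `1`
  have key := integral_vertical_sub_eq_tsum_of_doublePoles (F := F) (a := σ') (b := 2) (by linarith)
    ({1} : Set ℂ) (fun _ ↦ -(c / k))
    (fun p hp ↦ by rw [mem_singleton_iff.1 hp]; exact ⟨by simp; linarith, by norm_num⟩)
    (fun M ↦ (Set.finite_singleton (1 : ℂ)).subset (sep_subset _ _))
    (fun z hz1 hz2 hzP ↦ ?_) (fun p hp ↦ ?_) (Summable.of_finite)
    (integrable_line_mul_cpow hh hσ ⟨C₀, hC₀⟩ le_rfl (by linarith) hσ1.ne hk)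
    (integrable_line_mul_cpow hh hσ ⟨C₀, hC₀⟩ (by linarith) le_rfl (by norm_num) hk)
    (fun n : ℕ ↦ (n : ℝ) + 2) (fun n : ℕ ↦ max C₀ 0 / ((n : ℝ) + 2) ^ 2)
    (tendsto_natCast_atTop_atTop.atTop_add tendsto_const_nhds) ?_ (fun n p hp ↦ ?_) (fun n x hx ↦ ?_)
  · simp only [hFdef, Complex.ofReal_ofNat] at key
    rw [key, tsum_fintype, Finset.univ_unique, Finset.sum_singleton]
  · -- analyticity off the pole
    have hz1 : z ≠ 1 := hzP
    have hGa : AnalyticAt ℂ G z :=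
      (hasRightMellinContinuation_rightMellinExt_of_mem_sonineL one_pos hh).1.analyticAt
        (isOpen_ne.mem_nhds hz1)
    exact hGa.mul (hcpow.analyticAt z)
  · -- the pole at `1`
    rw [mem_singleton_iff.1 hp]
    refine ⟨φ, {s : ℂ | 1 / 2 < s.re}, hO.mem_nhds (by simp; norm_num), hφd, hderiv, fun z hz hz1 ↦ ?_⟩
    have hG1 := rightMellinExt_eq_of_half_lt_re h h₁ hh₁ hh hc hz hz1
    simp only [hFdef, hφ, hψ, hGdef, hM₁] at hG1 ⊢
    rw [hG1]
    have hz1' : z - 1 ≠ 0 := sub_ne_zero.2 hz1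
    have hz1'' : (1 : ℂ) - z ≠ 0 := sub_ne_zero.2 (Ne.symm hz1)
    field_simp
    ring
  · -- `δ_n → 0`
    have h1 : Tendsto (fun n : ℕ ↦ ((n : ℝ) + 2) ^ 2) atTop atTop :=
      (tendsto_pow_atTop two_ne_zero).comp (tendsto_natCast_atTop_atTop.atTop_add tendsto_const_nhds)
    exact tendsto_const_nhds.div_atTop h1
  · -- no pole on the lines
    rw [mem_singleton_iff.1 hp, Complex.one_im, abs_zero]
    exact (by positivity : (0 : ℝ) < (n : ℝ) + 2).ne
  · -- decay on the horizontal segments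
    have hT1 : 1 ≤ |(n : ℝ) + 2| := by rw [abs_of_nonneg (by positivity)]; linarith
    have hb : ∀ y : ℝ, |y| = (n : ℝ) + 2 →
        ‖F (x + y * I)‖ ≤ max C₀ 0 / ((n : ℝ) + 2) ^ 2 := by
      intro y hy
      have hy1 : 1 ≤ |y| := by rw [hy]; linarith
      have hGb := hC₀ (x + y * I) (by simpa using hx.1) (by simpa using hx.2) (by simpa using hy1)
      simp only [hFdef, norm_mul]
      have hy2 : (↑x + ↑y * I : ℂ).im ^ 2 = ((n : ℝ) + 2) ^ 2 := by
        rw [show (↑x + ↑y * I : ℂ).im = y by simp, ← sq_abs, hy]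
      have hGb' : ‖G (x + y * I)‖ ≤ C₀ / ((n : ℝ) + 2) ^ 2 := by rw [← hy2]; exact hGb
      have hk' := norm_natCast_cpow_neg_le_one hk (s := x + y * I) (by simp; linarith [hx.1])
      calc ‖G (x + y * I)‖ * ‖(k : ℂ) ^ (-(x + y * I))‖ ≤ (C₀ / ((n : ℝ) + 2) ^ 2) * 1 :=
            mul_le_mul hGb' hk' (norm_nonneg _) ((norm_nonneg _).trans hGb')
        _ ≤ max C₀ 0 / ((n : ℝ) + 2) ^ 2 := by
            rw [mul_one]; gcongr; exact le_max_left _ _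
    constructor
    · exact hb _ (by rw [abs_of_nonneg (by positivity)])
    · have e : ((x : ℂ) - (((n : ℝ) + 2 : ℝ) : ℂ) * I) = (x : ℂ) + ((-((n : ℝ) + 2) : ℝ) : ℂ) * I := by
        push_cast; ring
      rw [e]
      exact hb (-((n : ℝ) + 2)) (by rw [abs_neg, abs_of_nonneg (by positivity)])

include hh hc hh₁ hσ hσ1 hdec in
/-- **The `σ′`-line integral by Mellin inversion**: `∫ G_h(σ′+iy) k^{−(σ′+iy)} dy = 2πc/k`. On the line
`Re s = σ′ ∈ (1/2, 1)` the transform `ĥ(s) = ∫_0^∞ h(t)t^{−s}dt` converges absolutely, and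
`(k/2π)·∫ G_h(σ′+iy)k^{−(σ′+iy)}dy` is Mathlib's `mellinInv (1−σ′) (mellin h) (1/k)`, which equals the
value `c` of `h` at the continuity point `1/k ∈ (0,1)` (`k ≥ 2`), resp. the limit `c` of the continuous
inverse transform at `x = 1` (`k = 1`) — "The Fourier-Mellin inversion formula gives … `f(k) = +c/k`".
[cite: Burnol2004b, proof of Prop. 5.4 (arXiv:math/0203120v7 p. 14, TeX l.1161–1174)] -/
theorem integral_line_mul_cpow_eq {k : ℕ} (hk : 1 ≤ k) :
    ∫ y : ℝ, rightMellinExt h (σ' + y * I) * (k : ℂ) ^ (-(σ' + y * I)) = 2 * π * c / k := by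
  classical
  have hk0 : (k : ℂ) ≠ 0 := by exact_mod_cast (show k ≠ 0 by omega)
  have hkpos : (0 : ℝ) < k := by exact_mod_cast (show 0 < k by omega)
  set σ₀ : ℝ := 1 - σ' with hσ₀
  have hσ₀0 : 0 < σ₀ := by rw [hσ₀]; linarith
  have hσ₀1 : σ₀ < 1 / 2 := by rw [hσ₀]; linarith
  set G : ℂ → ℂ := rightMellinExt h with hGdef
  -- a representative of `h` equal to `c` on `(0,1)` everywhere
  set f : ℝ → ℂ := fun x ↦ if x ∈ Ioo (0 : ℝ) 1 then c else (h : ℝ → ℂ) x with hf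
  have hfae : f =ᵐ[volume] (h : ℝ → ℂ) := by
    filter_upwards [hc] with x hx
    by_cases hxI : x ∈ Ioo (0 : ℝ) 1
    · show (if x ∈ Ioo (0 : ℝ) 1 then c else (h : ℝ → ℂ) x) = (h : ℝ → ℂ) x
      rw [if_pos hxI]; exact (hx hxI).symm
    · show (if x ∈ Ioo (0 : ℝ) 1 then c else (h : ℝ → ℂ) x) = (h : ℝ → ℂ) x
      rw [if_neg hxI]
  have hmellin : ∀ w, mellin f w = mellin (h : ℝ → ℂ) w := fun w ↦ by
    refine integral_congr_ae ?_
    filter_upwards [ae_restrict_of_ae (s := Ioi (0 : ℝ)) hfae] with t ht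
    rw [ht]
  -- absolute convergence on the line `σ₀`
  have hconv : MellinConvergent f σ₀ := by
    have h0 := integrableOn_cpow_smul h h₁ hh₁ hc (w := (σ₀ : ℂ)) (by simpa using hσ₀0)
      (by simpa using hσ₀1)
    refine h0.congr_fun_ae ?_
    filter_upwards [ae_restrict_of_ae (s := Ioi (0 : ℝ)) hfae] with t ht
    rw [ht]
  -- on the line the transform is `G_h(σ' − iy)`
  have hline : ∀ y : ℝ, mellin f (σ₀ + y * I) = G (σ' + -(y : ℂ) * I) := by
    intro y
    rw [hmellin, hGdef, (hasRightMellinContinuation_rightMellinExt_of_mem_sonineL one_pos hh).2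
      ((σ' : ℂ) + -(y : ℂ) * I) (by simp; linarith) (by simp; linarith), rightMellin]
    congr 1
    rw [hσ₀]; push_cast; ring
  have hGint : Integrable fun y : ℝ ↦ G (σ' + y * I) :=
    integrable_line_of_strip_decay hh hdec le_rfl (by linarith) hσ1.ne
  have hvert : Complex.VerticalIntegrable (mellin f) σ₀ := by
    show Integrable (fun y : ℝ ↦ mellin f (σ₀ + y * I))
    simp_rw [hline]
    have h0 : Integrable fun y : ℝ ↦ G (σ' + ((-y : ℝ) : ℂ) * I) := hGint.comp_neg
    simpa only [Complex.ofReal_neg] using h0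
  -- Mellin inversion at the interior points of `(0,1)`
  have hinv : ∀ x ∈ Ioo (0 : ℝ) 1, mellinInv σ₀ (mellin f) x = c := by
    intro x hx
    have hcx : ContinuousAt f x := by
      have hev : (fun _ : ℝ ↦ c) =ᶠ[𝓝 x] f := by
        filter_upwards [isOpen_Ioo.mem_nhds hx] with t ht
        show c = if t ∈ Ioo (0 : ℝ) 1 then c else (h : ℝ → ℂ) t
        rw [if_pos ht]
      exact continuousAt_const.congr hev
    rw [mellinInv_mellin_eq σ₀ f hx.1 hconv hvert hcx]
    show (if x ∈ Ioo (0 : ℝ) 1 then c else (h : ℝ → ℂ) x) = c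
    rw [if_pos hx]
  -- continuity of the absolutely convergent inverse transform at `x = 1`
  have hIcont : ContinuousAt (fun x : ℝ ↦ mellinInv σ₀ (mellin f) x) 1 := by
    have hFc : Continuous fun y : ℝ ↦ mellin f (σ₀ + y * I) := by
      simp_rw [hline]
      have h0 : Continuous fun y : ℝ ↦ G (σ' + ((-y : ℝ) : ℂ) * I) :=
        (continuous_rightMellinExt_line hh hσ1.ne).comp continuous_neg
      simpa only [Complex.ofReal_neg] using h0
    have hint : ContinuousAt (fun x : ℝ ↦ ∫ y : ℝ, (x : ℂ) ^ (-(σ₀ + y * I)) • mellin f (σ₀ + y * I)) 1 := by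
      refine continuousAt_of_dominated (bound := fun y ↦ (1 / 2 : ℝ) ^ (-σ₀) * ‖mellin f (σ₀ + y * I)‖)
        ?_ ?_ (hvert.norm.const_mul _) ?_
      · filter_upwards [Ioi_mem_nhds one_pos] with x hx
        have hx0 : (x : ℂ) ≠ 0 := ofReal_ne_zero.2 (ne_of_gt hx)
        exact ((Continuous.const_cpow (by fun_prop) (Or.inl hx0)).smul hFc).aestronglyMeasurable
      · filter_upwards [Ioi_mem_nhds (by norm_num : (1 / 2 : ℝ) < 1)] with x hx
        have hx0 : 0 < x := lt_trans (by norm_num) hx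
        refine Eventually.of_forall fun y ↦ ?_
        rw [norm_smul, Complex.norm_cpow_eq_rpow_re_of_pos hx0]
        gcongr
        simp only [neg_re, add_re, ofReal_re, mul_re, I_re, mul_zero, ofReal_im, I_im, mul_one,
          sub_self, add_zero]
        exact Real.rpow_le_rpow_of_nonpos (by norm_num) hx.le (by linarith)
      · refine Eventually.of_forall fun y ↦ ?_
        have h1 : ContinuousAt (fun x : ℝ ↦ (x : ℂ) ^ (-(σ₀ + y * I))) 1 :=
          (continuousAt_cpow_const (by simp)).comp
            Complex.continuous_ofReal.continuousAt
        exact h1.smul continuousAt_const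
    exact hint.const_smul _
  have hI1 : mellinInv σ₀ (mellin f) 1 = c := by
    have h1 : Tendsto (fun x : ℝ ↦ mellinInv σ₀ (mellin f) x) (𝓝[<] 1)
        (𝓝 (mellinInv σ₀ (mellin f) 1)) := hIcont.tendsto.mono_left nhdsWithin_le_nhds
    have h2 : Tendsto (fun x : ℝ ↦ mellinInv σ₀ (mellin f) x) (𝓝[<] 1) (𝓝 c) := by
      refine tendsto_const_nhds.congr' ?_
      filter_upwards [Ioo_mem_nhdsLT one_pos] with x hx using (hinv x hx).symm
    exact tendsto_nhds_unique h1 h2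
  -- the value at `1/k`
  have hval : mellinInv σ₀ (mellin f) (1 / k) = c := by
    rcases eq_or_lt_of_le hk with h1 | h2
    · rw [← h1]; simpa using hI1
    · refine hinv _ ⟨by positivity, ?_⟩
      rw [div_lt_one hkpos]
      exact_mod_cast h2
  -- unfold and compute
  have hkinv : ∀ w : ℂ, (((1 / (k : ℝ) : ℝ) : ℂ)) ^ (-w) = (k : ℂ) ^ w := by
    intro w
    rw [one_div, Complex.ofReal_inv, Complex.ofReal_natCast, Complex.inv_cpow _ _ (by
      rw [Complex.natCast_arg]; exact Real.pi_pos.ne), Complex.cpow_neg, inv_inv]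
  have hrw : ∫ y : ℝ, (((1 / (k : ℝ) : ℝ) : ℂ)) ^ (-(σ₀ + y * I)) • mellin f (σ₀ + y * I) =
      (k : ℂ) * ∫ y : ℝ, G (σ' + y * I) * (k : ℂ) ^ (-(σ' + y * I)) := by
    have e : ∀ y : ℝ, (((1 / (k : ℝ) : ℝ) : ℂ)) ^ (-(σ₀ + y * I)) • mellin f (σ₀ + y * I) =
        (fun y : ℝ ↦ (k : ℂ) * (G (σ' + y * I) * (k : ℂ) ^ (-(σ' + y * I)))) (-y) := by
      intro y
      rw [hkinv, hline, smul_eq_mul]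
      simp only [Complex.ofReal_neg]
      have e1 : (σ₀ : ℂ) + y * I = 1 - (σ' + -(y : ℂ) * I) := by
        rw [hσ₀]; push_cast; ring
      rw [e1, Complex.cpow_sub _ _ hk0, cpow_one, Complex.cpow_neg]
      ring
    simp_rw [e]
    rw [integral_neg_eq_self (fun y : ℝ ↦ (k : ℂ) * (G (σ' + y * I) * (k : ℂ) ^ (-(σ' + y * I)))) volume,
      MeasureTheory.integral_const_mul]
  have hfinal : ((1 / (2 * π) : ℝ) : ℂ) * ((k : ℂ) * ∫ y : ℝ, G (σ' + y * I) * (k : ℂ) ^ (-(σ' + y * I)))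
      = c := by
    rw [← hrw, ← Complex.real_smul]
    exact hval
  have hπ : (π : ℂ) ≠ 0 := ofReal_ne_zero.2 Real.pi_pos.ne'
  set X : ℂ := ∫ y : ℝ, G (σ' + y * I) * (k : ℂ) ^ (-(σ' + y * I)) with hX
  have h2 : X = 2 * π * (((1 / (2 * π) : ℝ) : ℂ) * ((k : ℂ) * X)) / k := by
    push_cast
    field_simp
  rw [h2, hfinal]

include hh hc hh₁ hσ hσ1 hdec in
/-- **Lemma K**: `∫_{Re s = 2} G_h(s) k^{−s} ds = 0` for every integer `k ≥ 1` ("it will be enough to prove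
`0 = (1/2π)∫_{σ=2} G(s)k^{−s}|ds|` … Combining all this information the proof is complete").
[cite: Burnol2004b, proof of Prop. 5.4 (arXiv:math/0203120v7 p. 14, TeX l.1157–1174)] -/
theorem integral_line_two_mul_cpow_eq_zero {k : ℕ} (hk : 1 ≤ k) :
    ∫ y : ℝ, rightMellinExt h (2 + y * I) * (k : ℂ) ^ (-(2 + y * I)) = 0 := by
  have h1 := integral_line_two_sub_line_eq hh hc h₁ hh₁ hσ hσ1 hdec hk
  rw [integral_line_mul_cpow_eq hh hc h₁ hh₁ hσ hσ1 hdec hk] at h1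
  have hk0 : (k : ℂ) ≠ 0 := by exact_mod_cast (show k ≠ 0 by omega)
  have h2 : I * (∫ y : ℝ, rightMellinExt h (2 + y * I) * (k : ℂ) ^ (-(2 + y * I))) = 0 := by
    have e : I * (2 * π * c / k) + 2 * Real.pi * I * (-(c / k)) = 0 := by ring
    linear_combination h1 + e
  exact (mul_eq_zero.1 h2).resolve_left I_ne_zero

end LemmaK

/-! ## §D. The residue theorem on `[−1,2] × [−T_n,T_n]` and the limit `n → ∞` -/

/-- `ζ` is analytic off `s = 1`. [folklore] -/
private theorem analyticAt_zeta {z : ℂ} (hz : z ≠ 1) : AnalyticAt ℂ riemannZeta z :=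
  analyticOn_riemannZeta z hz

/-- `‖μ(k) k^{−s}‖ ≤ k^{−Re s}` for all `k` (for `k = 0` both sides vanish or the right side is `≥ 0`).
[folklore] -/
private theorem norm_term_moebius_le' {s : ℂ} (hs : s.re ≠ 0) (k : ℕ) :
    ‖LSeries.term (fun n : ℕ ↦ ((ArithmeticFunction.moebius n : ℤ) : ℂ)) s k‖ ≤ (k : ℝ) ^ (-s.re) := by
  refine (norm_term_moebius_le s k).trans ?_
  split_ifs with hk
  · rw [hk, Nat.cast_zero, Real.zero_rpow (neg_ne_zero.2 hs)]
  · exact le_rfl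

/-- `‖1/ζ(2+iy)‖ ≤ Σ_k k^{−2}` on the line `Re s = 2`. [folklore] -/
private theorem norm_inv_zeta_line_two_le (y : ℝ) :
    ‖(riemannZeta (2 + y * I))⁻¹‖ ≤ ∑' k : ℕ, (k : ℝ) ^ (-(2 : ℝ)) := by
  have hre : ((2 : ℂ) + y * I).re = 2 := by simp
  have hS : Summable fun k : ℕ ↦ (k : ℝ) ^ (-(2 : ℝ)) := Real.summable_nat_rpow.2 (by norm_num)
  have hb : ∀ k, ‖LSeries.term (fun n : ℕ ↦ ((ArithmeticFunction.moebius n : ℤ) : ℂ)) (2 + y * I) k‖ ≤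
      (k : ℝ) ^ (-(2 : ℝ)) := fun k ↦ by
    simpa [hre] using norm_term_moebius_le' (s := 2 + y * I) (by simp) k
  have hn : Summable fun k ↦ ‖LSeries.term (fun n : ℕ ↦ ((ArithmeticFunction.moebius n : ℤ) : ℂ))
      (2 + y * I) k‖ := Summable.of_nonneg_of_le (fun _ ↦ norm_nonneg _) hb hS
  rw [inv_zeta_eq_LSeries_moebius (by simp), LSeries]
  exact (norm_tsum_le_tsum_norm hn).trans (hn.tsum_le_tsum hb hS)

/-- Continuity of `y ↦ 1/ζ(2+iy)`. [folklore] -/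
private theorem continuous_inv_zeta_line_two : Continuous fun y : ℝ ↦ (riemannZeta (2 + y * I))⁻¹ := by
  refine continuous_iff_continuousAt.2 fun y ↦ ?_
  have hne1 : (2 : ℂ) + y * I ≠ 1 := fun h ↦ by simpa using congrArg Complex.re h
  have hz : riemannZeta (2 + y * I) ≠ 0 := riemannZeta_ne_zero_of_one_lt_re (by simp)
  exact ((differentiableAt_riemannZeta hne1).continuousAt.comp (x := y)
    (f := fun y : ℝ ↦ (2 : ℂ) + y * I) (by fun_prop)).inv₀ hz

/-- **Telescoping bound ⇒ summable**: if `0 ≤ a n ≤ a (n+1) ≤ B` for all `n`, then the increments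
`a (n+1) − a n` are summable. [folklore] -/
private theorem summable_sub_of_monotone_bounded {a : ℕ → ℝ} (hmono : Monotone a) {B : ℝ} (hB : ∀ n, a n ≤ B) :
    Summable fun n ↦ a (n + 1) - a n := by
  refine summable_of_sum_range_le (c := B - a 0) (fun n ↦ sub_nonneg.2 (hmono (Nat.le_succ n))) fun n ↦ ?_
  rw [Finset.sum_range_sub]
  linarith [hB n]

/-- The increment of symmetric interval integrals is bounded by the increment of the integrals of
the norm: `‖∫_{−T'}^{T'} φ − ∫_{−T}^{T} φ‖ ≤ ∫_{−T'}^{T'} ‖φ‖ − ∫_{−T}^{T} ‖φ‖` for `0 ≤ T ≤ T'`.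
[folklore] -/
private theorem norm_intervalIntegral_sub_le {φ : ℝ → ℂ} (hφ : Integrable φ) {T T' : ℝ} (hTT' : T ≤ T') :
    ‖(∫ y in (-T')..T', φ y) - ∫ y in (-T)..T, φ y‖ ≤
      (∫ y in (-T')..T', ‖φ y‖) - ∫ y in (-T)..T, ‖φ y‖ := by
  have hi : ∀ a b : ℝ, IntervalIntegrable φ volume a b := fun a b ↦ hφ.intervalIntegrable
  have hin : ∀ a b : ℝ, IntervalIntegrable (fun y ↦ ‖φ y‖) volume a b := fun a b ↦
    hφ.norm.intervalIntegrable
  have e1 : ∫ y in (-T')..T', φ y =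
      (∫ y in (-T')..(-T), φ y) + ((∫ y in (-T)..T, φ y) + ∫ y in T..T', φ y) := by
    rw [intervalIntegral.integral_add_adjacent_intervals (hi _ _) (hi _ _),
      intervalIntegral.integral_add_adjacent_intervals (hi _ _) (hi _ _)]
  have e2 : ∫ y in (-T')..T', ‖φ y‖ =
      (∫ y in (-T')..(-T), ‖φ y‖) + ((∫ y in (-T)..T, ‖φ y‖) + ∫ y in T..T', ‖φ y‖) := by
    rw [intervalIntegral.integral_add_adjacent_intervals (hin _ _) (hin _ _),
      intervalIntegral.integral_add_adjacent_intervals (hin _ _) (hin _ _)]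
  rw [e1, e2]
  have h1 := intervalIntegral.norm_integral_le_integral_norm (f := φ) (μ := volume)
    (neg_le_neg hTT' : -T' ≤ -T)
  have h2 := intervalIntegral.norm_integral_le_integral_norm (f := φ) (μ := volume) hTT'
  calc ‖(∫ y in (-T')..(-T), φ y) + ((∫ y in (-T)..T, φ y) + ∫ y in T..T', φ y) - ∫ y in (-T)..T, φ y‖
      = ‖(∫ y in (-T')..(-T), φ y) + ∫ y in T..T', φ y‖ := by ring_nf
    _ ≤ ‖∫ y in (-T')..(-T), φ y‖ + ‖∫ y in T..T', φ y‖ := norm_add_le _ _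
    _ ≤ (∫ y in (-T')..(-T), ‖φ y‖) + ∫ y in T..T', ‖φ y‖ := add_le_add h1 h2
    _ = _ := by ring

/-- **Prop. 5.4 holds** (Burnol 2004b): for `G ∈ 𝓛̂₁` the series of residues `Σ_ρ Res_{s=ρ} G(s)/ζ(s)`
("`= Σ_ρ G(ρ)/ζ′(ρ)`" for simple zeros), summed along any height sequence of Prop. 5.1, is absolutely
convergent in the sense of Note 5 and its value is `0`. [cite: Burnol2004b, Prop. 5.4 (arXiv:math/0203120v7 p. 14, TeX l.1131–1174)] -/
theorem Burnol2004b_prop5_4_holds' : Burnol2004b_prop5_4 := by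
  intro A T hT g hg
  classical
  -- data
  have hg1 : g ∈ sonineL 1 := hg.1
  obtain ⟨heven, ⟨c, hc⟩, -⟩ := hg1
  have hgm : MemLp (Set.indicator {x : ℝ | 1 < |x|} (g : ℝ → ℂ)) 2 volume :=
    (Lp.memLp g).indicator (isOpen_lt continuous_const continuous_abs).measurableSet
  set g₁ : Lp ℂ 2 (volume : Measure ℝ) := hgm.toLp _ with hg₁def
  have hg₁ : ∀ᵐ x : ℝ, g₁ x = Set.indicator {x : ℝ | 1 < |x|} (g : ℝ → ℂ) x := hgm.coeFn_toLp
  set G : ℂ → ℂ := rightMellinExt g with hGdef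
  set F : ℂ → ℂ := fun s ↦ G s / riemannZeta s with hFdef
  -- the Fourier side `h = 𝓕 g`
  set hF : Lp ℂ 2 (volume : Measure ℝ) := 𝓕 g with hhFdef
  have hhF : hF ∈ sonineL 1 := fourier_mem_sonineL hg.1
  obtain ⟨-, ⟨c', hc'⟩, -⟩ := hhF
  have hhm : MemLp (Set.indicator {x : ℝ | 1 < |x|} (hF : ℝ → ℂ)) 2 volume :=
    (Lp.memLp hF).indicator (isOpen_lt continuous_const continuous_abs).measurableSet
  set h₁ : Lp ℂ 2 (volume : Measure ℝ) := hhm.toLp _ with hh₁def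
  have hh₁ : ∀ᵐ x : ℝ, h₁ x = Set.indicator {x : ℝ | 1 < |x|} (hF : ℝ → ℂ) x := hhm.coeFn_toLp
  set H : ℂ → ℂ := rightMellinExt hF with hHdef
  -- height sequence facts
  have hTpos : ∀ n, 0 < T n := fun n ↦ lt_of_le_of_lt (Nat.cast_nonneg n) (hT.2.1 n)
  have hTmono : Monotone T := hT.1.monotone
  have hTtop : Tendsto T atTop atTop :=
    tendsto_atTop_mono (fun n ↦ (hT.2.1 n).le) tendsto_natCast_atTop_atTop
  -- the two vertical line integrals vanish
  have hdec2 : ∃ C : ℝ, ∀ u : ℂ, (3 / 4 : ℝ) ≤ u.re → u.re ≤ 2 → 1 ≤ |u.im| → ‖G u‖ ≤ C / u.im ^ 2 := by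
    obtain ⟨C, hC⟩ := hg.2 (3 / 4) 2 2
    refine ⟨max C 0, fun u h1 h2 h3 ↦ ?_⟩
    have h := hC u h1 h2 h3
    have hui0 : 0 < |u.im| := by linarith
    have hn : |u.im| ≤ ‖u‖ := abs_im_le_norm u
    have hpow : ‖u‖ ^ (-((2 : ℕ) : ℝ)) ≤ |u.im| ^ (-((2 : ℕ) : ℝ)) :=
      Real.rpow_le_rpow_of_nonpos hui0 hn (by norm_num)
    calc ‖G u‖ ≤ C * ‖u‖ ^ (-((2 : ℕ) : ℝ)) := h
      _ ≤ max C 0 * ‖u‖ ^ (-((2 : ℕ) : ℝ)) := by gcongr; exact le_max_left _ _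
      _ ≤ max C 0 * |u.im| ^ (-((2 : ℕ) : ℝ)) := mul_le_mul_of_nonneg_left hpow (le_max_right _ _)
      _ = max C 0 / u.im ^ 2 := by
          rw [Real.rpow_neg (abs_nonneg _), show ((2 : ℕ) : ℝ) = (2 : ℕ) by norm_num, Real.rpow_natCast,
            sq_abs, div_eq_mul_inv]
  have hdecH : ∃ C : ℝ, ∀ u : ℂ, (3 / 4 : ℝ) ≤ u.re → u.re ≤ 2 → 1 ≤ |u.im| → ‖H u‖ ≤ C / u.im ^ 2 :=
    exists_fourier_strip_decay hg (by norm_num)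
  have hGint2 : Integrable fun y : ℝ ↦ G (2 + y * I) := by
    have := integrable_line_of_strip_decay hg.1 hdec2 (σ := 2) (by norm_num) le_rfl (by norm_num)
    simpa using this
  have hHint2 : Integrable fun y : ℝ ↦ H (2 + y * I) := by
    have := integrable_line_of_strip_decay (fourier_mem_sonineL hg.1) hdecH (σ := 2) (by norm_num) le_rfl
      (by norm_num)
    simpa using this
  have hGc2 : Continuous fun y : ℝ ↦ G (2 + y * I) := by
    simpa using continuous_rightMellinExt_line hg.1 (σ := 2) (by norm_num)
  have hHc2 : Continuous fun y : ℝ ↦ H (2 + y * I) := by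
    simpa using continuous_rightMellinExt_line (fourier_mem_sonineL hg.1) (σ := 2) (by norm_num)
  have hV2 : ∫ y : ℝ, F (2 + y * I) = 0 := by
    refine integral_div_zeta_line_two_eq_zero hGc2 hGint2 fun k hk ↦ ?_
    have := integral_line_two_mul_cpow_eq_zero hg.1 hc g₁ hg₁ (σ' := 3 / 4) (by norm_num) (by norm_num)
      hdec2 hk
    simpa using this
  have hVH : ∫ y : ℝ, H (2 + y * I) / riemannZeta (2 + y * I) = 0 := by
    refine integral_div_zeta_line_two_eq_zero hHc2 hHint2 fun k hk ↦ ?_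
    have := integral_line_two_mul_cpow_eq_zero (fourier_mem_sonineL hg.1) hc' h₁ hh₁ (σ' := 3 / 4)
      (by norm_num) (by norm_num) hdecH hk
    simpa using this
  have hFneg1 : ∀ y : ℝ, F (-1 + y * I) =
      (fun y : ℝ ↦ H (2 + y * I) / riemannZeta (2 + y * I)) (-y) := fun y ↦
    div_zeta_neg_one_line hg.1 y
  have hVm1 : ∫ y : ℝ, F (-1 + y * I) = 0 := by
    simp_rw [hFneg1]
    rw [integral_neg_eq_self (fun y : ℝ ↦ H (2 + y * I) / riemannZeta (2 + y * I)) volume]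
    exact hVH
  -- integrability along the two vertical lines
  obtain ⟨B, hB⟩ : ∃ B : ℝ, ∀ y : ℝ, ‖(riemannZeta (2 + y * I))⁻¹‖ ≤ B :=
    ⟨_, norm_inv_zeta_line_two_le⟩
  have hFint2 : Integrable fun y : ℝ ↦ F (2 + y * I) := by
    have := hGint2.mul_bdd (c := B) continuous_inv_zeta_line_two.aestronglyMeasurable
      (Eventually.of_forall hB)
    simpa [hFdef, div_eq_mul_inv] using this
  have hHFint : Integrable fun y : ℝ ↦ H (2 + y * I) / riemannZeta (2 + y * I) := by
    have := hHint2.mul_bdd (c := B) continuous_inv_zeta_line_two.aestronglyMeasurable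
      (Eventually.of_forall hB)
    simpa [div_eq_mul_inv] using this
  have hFintm1 : Integrable fun y : ℝ ↦ F (-1 + y * I) := by
    simp_rw [hFneg1]
    exact hHFint.comp_neg
  -- the finite sets of zeros and the partial sums
  set Z : ℕ → Finset ℂ := fun n ↦ (ntz_below_finite (T n)).toFinset with hZdef
  have hZ : ∀ n ρ, ρ ∈ Z n ↔ ρ ∈ ZetaZeros.riemannZetaNontrivialZeros ∧ |ρ.im| < T n := fun n ρ ↦ by
    simp [hZdef]
  have hSum : ∀ n, burnolInvZetaResiduePartialSum G T n = ∑ ρ ∈ Z n, residueAt F ρ := fun n ↦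
    finsum_mem_eq_finite_toFinset_sum _ (ntz_below_finite (T n))
  -- the removable point `s = 1`
  have hnear := div_zeta_eventuallyEq_near_one g g₁ hg₁ hg.1 hc
  have hΦan := analyticAt_numerator_div_zeta₁ g g₁ hg₁ c
  have hres1 : residueAt F 1 = 0 := by
    have hΦd : ∀ᶠ z in 𝓝[≠] (1 : ℂ), DifferentiableAt ℂ
        (fun s ↦ (-c + (s - 1) * mellin (g₁ : ℝ → ℂ) (1 - s)) / riemannZeta₁ s) z :=
      (hΦan.eventually_analyticAt.filter_mono nhdsWithin_le_nhds).mono fun z hz ↦ hz.differentiableAt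
    rw [residueAt_congr hΦd hnear.symm]
    exact residueAt_of_analyticAt hΦan
  -- pole neighbourhoods: open `V ∋ p` with `F` differentiable on `V ∖ {p}`
  have hV : ∀ p : ℂ, (p ∈ ZetaZeros.riemannZetaNontrivialZeros ∨ p = 1) →
      ∃ V : Set ℂ, IsOpen V ∧ p ∈ V ∧ ∀ z ∈ V, z ≠ p → DifferentiableAt ℂ F z := by
    intro p hp
    rcases hp with hp | rfl
    · have hρ := mem_riemannZetaNontrivialZeros_iff_holds.1 hp
      have hρ1 : p ≠ 1 := fun h1 ↦ by rw [h1] at hρ; norm_num at hρ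
      have hev1 : ∀ᶠ z in 𝓝[≠] p, riemannZeta z ≠ 0 := by
        have h := (isDiscrete_iff_nhdsNE.1 isDiscrete_riemannZetaZeros) p hρ.1
        rw [Filter.inf_principal_eq_bot] at h
        filter_upwards [h] with z hz
        simpa [mem_riemannZetaZeros] using hz
      have hev : ∀ᶠ z in 𝓝 p, (z ≠ p → riemannZeta z ≠ 0) ∧ z ≠ 1 :=
        (eventually_nhdsWithin_iff.1 hev1).and (isOpen_ne.mem_nhds hρ1)
      obtain ⟨V, hVsub, hVo, hpV⟩ := mem_nhds_iff.1 hev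
      refine ⟨V, hVo, hpV, fun z hz hzp ↦ ?_⟩
      have h' := hVsub hz
      exact (differentiableAt_rightMellinExt hg.1 h'.2).div (differentiableAt_riemannZeta h'.2) (h'.1 hzp)
    · have hev : ∀ᶠ z in 𝓝 (1 : ℂ), (z ≠ 1 → F z =
          (fun s ↦ (-c + (s - 1) * mellin (g₁ : ℝ → ℂ) (1 - s)) / riemannZeta₁ s) z) ∧
          AnalyticAt ℂ (fun s ↦ (-c + (s - 1) * mellin (g₁ : ℝ → ℂ) (1 - s)) / riemannZeta₁ s) z :=
        (eventually_nhdsWithin_iff.1 hnear).and hΦan.eventually_analyticAt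
      obtain ⟨V, hVsub, hVo, h1V⟩ := mem_nhds_iff.1 hev
      refine ⟨V, hVo, h1V, fun z hz hz1 ↦ ?_⟩
      have hev' : F =ᶠ[𝓝 z] fun s ↦ (-c + (s - 1) * mellin (g₁ : ℝ → ℂ) (1 - s)) / riemannZeta₁ s := by
        filter_upwards [hVo.mem_nhds hz, isOpen_ne.mem_nhds hz1] with w hw hw1
        exact (hVsub hw).1 hw1
      exact (hVsub hz).2.differentiableAt.congr_of_eventuallyEq hev'
  choose! V hVo hpV hVd using hV
  -- the residue theorem on `[−1,2] × [−T_n, T_n]`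
  have hrect : ∀ n, rectBoundaryIntegral F (-1) 2 (-T n) (T n) =
      2 * Real.pi * I * ∑ ρ ∈ Z n, residueAt F ρ := by
    intro n
    set S' : Finset ℂ := insert 1 (Z n) with hS'
    have hS'mem : ∀ p ∈ S', p ∈ ZetaZeros.riemannZetaNontrivialZeros ∨ p = 1 := by
      intro p hp
      rcases Finset.mem_insert.1 hp with h1 | hpZ
      · exact Or.inr h1
      · exact Or.inl ((hZ n p).1 hpZ).1
    have h1Z : (1 : ℂ) ∉ Z n := by
      intro h1
      have := mem_riemannZetaNontrivialZeros_iff_holds.1 ((hZ n 1).1 h1).1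
      exact riemannZeta_one_ne_zero this.1
    set U : Set ℂ := {z | AnalyticAt ℂ F z} ∪ ⋃ p ∈ S', V p with hU
    have hUo : IsOpen U :=
      (isOpen_analyticAt ℂ F).union (isOpen_biUnion fun p hp ↦ hVo p (hS'mem p hp))
    have key := rectBoundaryIntegral_eq_sum_residueAt (a := -1) (b := 2) (c := -T n) (d := T n)
      (by norm_num) (by linarith [hTpos n]) S' F U hUo ?_ ?_ ?_ ?_
    · rw [key, hS', Finset.sum_insert h1Z, hres1, zero_add]
    · -- the closed rectangle lies in `U`
      intro z hz
      rw [mem_reProdIm] at hz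
      by_cases hzS : z ∈ S'
      · exact Or.inr (mem_iUnion₂.2 ⟨z, hzS, hpV z (hS'mem z hzS)⟩)
      · left
        have hz1 : z ≠ 1 := fun h1 ↦ hzS (by rw [hS', h1]; exact Finset.mem_insert_self _ _)
        have hζ : riemannZeta z ≠ 0 := by
          intro h0
          obtain ⟨hntz, -, -⟩ := mem_ntz_of_zero h0 hz.1.1
          have hne : |z.im| ≠ T n := fun habs ↦ zeta_ne_zero_of_isInvZetaHeightSeq hT n habs hz.1.1 h0
          have hlt : |z.im| < T n := lt_of_le_of_ne (abs_le.2 hz.2) hne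
          exact hzS (by rw [hS']; exact Finset.mem_insert_of_mem ((hZ n z).2 ⟨hntz, hlt⟩))
        have hev : ∀ᶠ w in 𝓝 z, DifferentiableAt ℂ F w := by
          filter_upwards [(differentiableAt_riemannZeta hz1).continuousAt.eventually_ne hζ,
            isOpen_ne.mem_nhds hz1] with w hw hw1
          exact (differentiableAt_rightMellinExt hg.1 hw1).div (differentiableAt_riemannZeta hw1) hw
        exact Complex.analyticAt_iff_eventually_differentiableAt.2 hev
    · -- the poles lie in the open rectangle
      intro p hp
      rw [mem_reProdIm]
      rcases Finset.mem_insert.1 (Finset.mem_coe.1 hp) with h1 | hpZ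
      · rw [h1]
        exact ⟨⟨by norm_num, by norm_num⟩, ⟨by simp; exact hTpos n, by simp; exact hTpos n⟩⟩
      · obtain ⟨hntz, hlt⟩ := (hZ n p).1 hpZ
        have h := mem_riemannZetaNontrivialZeros_iff_holds.1 hntz
        exact ⟨⟨by linarith [h.2.1], by linarith [h.2.2]⟩, abs_lt.1 hlt⟩
    · -- differentiability on `U ∖ S'`
      intro z hz
      have hzS : z ∉ S' := fun h' ↦ hz.2 (Finset.mem_coe.2 h')
      rcases hz.1 with h' | h'
      · exact h'.differentiableAt.differentiableWithinAt
      · obtain ⟨p, hp, hzp⟩ := mem_iUnion₂.1 h'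
        exact (hVd p (hS'mem p hp) z hzp (fun h'' ↦ hzS (h'' ▸ hp))).differentiableWithinAt
    · -- meromorphy at the poles
      intro p hp
      rcases Finset.mem_insert.1 hp with h1 | hpZ
      · rw [h1]; exact hΦan.meromorphicAt.congr hnear.symm
      · have hntz := ((hZ n p).1 hpZ).1
        have h := mem_riemannZetaNontrivialZeros_iff_holds.1 hntz
        have hp1 : p ≠ 1 := by intro h1; rw [h1] at h; norm_num at h
        have hGa : AnalyticAt ℂ G p :=
          (hasRightMellinContinuation_rightMellinExt_of_mem_sonineL one_pos hg.1).1.analyticAt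
            (isOpen_ne.mem_nhds hp1)
        exact hGa.meromorphicAt.div (analyticAt_zeta hp1).meromorphicAt
  -- the four sides
  set bot : ℕ → ℂ := fun n ↦ ∫ x in (-1 : ℝ)..2, F (x + ((-T n : ℝ) : ℂ) * I) with hbot
  set top : ℕ → ℂ := fun n ↦ ∫ x in (-1 : ℝ)..2, F (x + ((T n : ℝ) : ℂ) * I) with htop
  set rgt : ℕ → ℂ := fun n ↦ ∫ y in (-T n)..T n, F (2 + y * I) with hrgt
  set lft : ℕ → ℂ := fun n ↦ ∫ y in (-T n)..T n, F (-1 + y * I) with hlft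
  have hRBI : ∀ n, rectBoundaryIntegral F (-1) 2 (-T n) (T n) = bot n - top n + I * rgt n - I * lft n := by
    intro n
    simp only [rectBoundaryIntegral_def, hbot, htop, hrgt, hlft, Complex.ofReal_ofNat, Complex.ofReal_neg,
      Complex.ofReal_one]
  have h2πI : (2 * Real.pi * I : ℂ) ≠ 0 := by
    simp [Real.pi_pos.ne', I_ne_zero]
  have hSeq : ∀ n, burnolInvZetaResiduePartialSum G T n =
      (2 * Real.pi * I)⁻¹ * (bot n - top n + I * rgt n - I * lft n) := by
    intro n
    rw [hSum n, ← hRBI n, hrect n, ← mul_assoc, inv_mul_cancel₀ h2πI, one_mul]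
  -- horizontal decay
  set N : ℕ := ⌈A⌉₊ + 2 with hN
  obtain ⟨CN, hCN⟩ := hg.2 (-1) 2 N
  have hAN : A - N ≤ -2 := by
    have := Nat.le_ceil A
    rw [hN]; push_cast; linarith
  have hhor : ∀ n, 1 ≤ n → ∀ x ∈ Icc (-1 : ℝ) 2, ∀ y : ℝ, |y| = T n →
      ‖F (x + y * I)‖ ≤ max CN 0 / T n ^ 2 := by
    intro n hn x hx y hy
    have hTn1 : 1 ≤ T n := by
      have h1 := hT.2.1 n
      have h2 : (1 : ℝ) ≤ n := by exact_mod_cast hn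
      linarith
    set s : ℂ := x + y * I with hs
    have hsre : s.re = x := by simp [hs]
    have hsim : s.im = y := by simp [hs]
    have hζ := hT.2.2 n s (by rw [hsim]; exact hy) (by rw [hsre]; exact hx.1) (by rw [hsre]; exact hx.2)
    have hGs := hCN s (by rw [hsre]; exact hx.1) (by rw [hsre]; exact hx.2) (by rw [hsim, hy]; exact hTn1)
    have hTle : T n ≤ ‖s‖ := by rw [← hy, ← hsim]; exact abs_im_le_norm s
    have hs1 : 1 ≤ ‖s‖ := hTn1.trans hTle
    have hs0 : 0 < ‖s‖ := by linarith
    calc ‖F s‖ = ‖G s‖ * ‖riemannZeta s‖⁻¹ := by simp [hFdef, div_eq_mul_inv]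
      _ ≤ (max CN 0 * ‖s‖ ^ (-(N : ℝ))) * ‖s‖ ^ A :=
          mul_le_mul (hGs.trans (by gcongr; exact le_max_left _ _)) hζ.le (inv_nonneg.2 (norm_nonneg _))
            (by positivity)
      _ = max CN 0 * ‖s‖ ^ (A - N) := by
          rw [mul_assoc, ← Real.rpow_add hs0]; ring_nf
      _ ≤ max CN 0 * ‖s‖ ^ (-(2 : ℝ)) :=
          mul_le_mul_of_nonneg_left (Real.rpow_le_rpow_of_exponent_le hs1 hAN) (le_max_right _ _)
      _ ≤ max CN 0 * (T n) ^ (-(2 : ℝ)) :=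
          mul_le_mul_of_nonneg_left (Real.rpow_le_rpow_of_nonpos (hTpos n) hTle (by norm_num))
            (le_max_right _ _)
      _ = max CN 0 / T n ^ 2 := by
          rw [show (-(2 : ℝ)) = -((2 : ℕ) : ℝ) by norm_num, Real.rpow_neg (hTpos n).le, Real.rpow_natCast,
            div_eq_mul_inv]
  have hbot_le : ∀ n, 1 ≤ n → ‖bot n‖ ≤ max CN 0 / T n ^ 2 * |(2 : ℝ) - (-1)| := by
    intro n hn
    refine intervalIntegral.norm_integral_le_of_norm_le_const fun x hx ↦ ?_
    rw [uIoc_of_le (by norm_num)] at hx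
    exact hhor n hn x ⟨hx.1.le, hx.2⟩ (-T n) (by rw [abs_neg, abs_of_pos (hTpos n)])
  have htop_le : ∀ n, 1 ≤ n → ‖top n‖ ≤ max CN 0 / T n ^ 2 * |(2 : ℝ) - (-1)| := by
    intro n hn
    refine intervalIntegral.norm_integral_le_of_norm_le_const fun x hx ↦ ?_
    rw [uIoc_of_le (by norm_num)] at hx
    exact hhor n hn x ⟨hx.1.le, hx.2⟩ (T n) (abs_of_pos (hTpos n))
  -- limits of the four sides
  have hδ : Tendsto (fun n ↦ max CN 0 / T n ^ 2 * |(2 : ℝ) - (-1)|) atTop (𝓝 0) := by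
    have h1 : Tendsto (fun n ↦ T n ^ 2) atTop atTop := (tendsto_pow_atTop two_ne_zero).comp hTtop
    simpa using (tendsto_const_nhds.div_atTop h1).mul_const |(2 : ℝ) - (-1)|
  have hbot0 : Tendsto bot atTop (𝓝 0) :=
    squeeze_zero_norm' (eventually_atTop.2 ⟨1, hbot_le⟩) hδ
  have htop0 : Tendsto top atTop (𝓝 0) :=
    squeeze_zero_norm' (eventually_atTop.2 ⟨1, htop_le⟩) hδ
  have hneg : Tendsto (fun n ↦ -T n) atTop atBot := tendsto_neg_atTop_atBot.comp hTtop
  have hrgt0 : Tendsto rgt atTop (𝓝 0) := by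
    have := intervalIntegral_tendsto_integral hFint2 hneg hTtop
    rwa [hV2] at this
  have hlft0 : Tendsto lft atTop (𝓝 0) := by
    have := intervalIntegral_tendsto_integral hFintm1 hneg hTtop
    rwa [hVm1] at this
  -- (1) the partial sums tend to `0`
  have hlim : Tendsto (fun n ↦ burnolInvZetaResiduePartialSum G T n) atTop (𝓝 0) := by
    have h := (((hbot0.sub htop0).add (hrgt0.const_mul I)).sub (hlft0.const_mul I)).const_mul
      (2 * Real.pi * I)⁻¹
    simp only [sub_zero, mul_zero, add_zero] at h
    refine h.congr fun n ↦ ?_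
    rw [hSeq n]
  -- (2) the increments are summable
  have hTsucc : ∀ n, T n ≤ T (n + 1) := fun n ↦ hTmono (Nat.le_succ n)
  set ap : ℕ → ℝ := fun n ↦ ∫ y in (-T n)..T n, ‖F (2 + y * I)‖ with hap
  set am : ℕ → ℝ := fun n ↦ ∫ y in (-T n)..T n, ‖F (-1 + y * I)‖ with ham
  have hrgt_le : ∀ n, ‖rgt (n + 1) - rgt n‖ ≤ ap (n + 1) - ap n := fun n ↦
    norm_intervalIntegral_sub_le hFint2 (hTsucc n)
  have hlft_le : ∀ n, ‖lft (n + 1) - lft n‖ ≤ am (n + 1) - am n := fun n ↦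
    norm_intervalIntegral_sub_le hFintm1 (hTsucc n)
  have hap_sum : Summable fun n ↦ ap (n + 1) - ap n := by
    refine summable_sub_of_monotone_bounded (monotone_nat_of_le_succ fun n ↦ ?_)
      (B := ∫ y : ℝ, ‖F (2 + y * I)‖) fun n ↦ ?_
    · linarith [hrgt_le n, norm_nonneg (rgt (n + 1) - rgt n)]
    · rw [hap]
      simp only
      rw [intervalIntegral.integral_of_le (by linarith [hTpos n])]
      exact setIntegral_le_integral hFint2.norm (Eventually.of_forall fun y ↦ norm_nonneg _)
  have ham_sum : Summable fun n ↦ am (n + 1) - am n := by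
    refine summable_sub_of_monotone_bounded (monotone_nat_of_le_succ fun n ↦ ?_)
      (B := ∫ y : ℝ, ‖F (-1 + y * I)‖) fun n ↦ ?_
    · linarith [hlft_le n, norm_nonneg (lft (n + 1) - lft n)]
    · rw [ham]
      simp only
      rw [intervalIntegral.integral_of_le (by linarith [hTpos n])]
      exact setIntegral_le_integral hFintm1.norm (Eventually.of_forall fun y ↦ norm_nonneg _)
  -- summability of the horizontal sides
  have hmaj : Summable fun n : ℕ ↦ 3 * max CN 0 / ((n : ℝ) + 1) ^ 2 := by
    have h1 : Summable fun n : ℕ ↦ 1 / ((n : ℝ) + 1) ^ 2 := by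
      have := (summable_nat_add_iff 1).2 (Real.summable_one_div_nat_pow.2 one_lt_two)
      refine this.congr fun n ↦ ?_
      push_cast; ring_nf
    refine (h1.mul_left (3 * max CN 0)).congr fun n ↦ ?_
    ring
  have hhor_sum : ∀ side : ℕ → ℂ, (∀ n, 1 ≤ n → ‖side n‖ ≤ max CN 0 / T n ^ 2 * |(2 : ℝ) - (-1)|) →
      Summable fun n ↦ ‖side n‖ := by
    intro side hside
    refine (summable_nat_add_iff 1).1 (Summable.of_nonneg_of_le (fun n ↦ norm_nonneg _) (fun n ↦ ?_) hmaj)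
    have hn1 : (n : ℝ) + 1 < T (n + 1) := by have := hT.2.1 (n + 1); push_cast at this; exact this
    have hn0 : (0 : ℝ) < (n : ℝ) + 1 := by positivity
    calc ‖side (n + 1)‖ ≤ max CN 0 / T (n + 1) ^ 2 * |(2 : ℝ) - (-1)| := hside (n + 1) (by omega)
      _ = 3 * max CN 0 / T (n + 1) ^ 2 := by norm_num; ring
      _ ≤ 3 * max CN 0 / ((n : ℝ) + 1) ^ 2 := by
          apply div_le_div_of_nonneg_left (by positivity) (by positivity)
          exact pow_le_pow_left₀ hn0.le hn1.le 2
  have hbot_sum := hhor_sum bot hbot_le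
  have htop_sum := hhor_sum top htop_le
  -- the bound on the increments
  have htri : ∀ b t r l : ℂ, ‖b - t + I * r - I * l‖ ≤ ‖b‖ + ‖t‖ + ‖r‖ + ‖l‖ := by
    intro b t r l
    calc ‖b - t + I * r - I * l‖ ≤ ‖b - t + I * r‖ + ‖I * l‖ := norm_sub_le _ _
      _ ≤ ‖b - t‖ + ‖I * r‖ + ‖I * l‖ := by gcongr; exact norm_add_le _ _
      _ ≤ ‖b‖ + ‖t‖ + ‖I * r‖ + ‖I * l‖ := by gcongr; exact norm_sub_le _ _
      _ = ‖b‖ + ‖t‖ + ‖r‖ + ‖l‖ := by simp [Complex.norm_I]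
  have hnorm2πI : ‖(2 * Real.pi * I : ℂ)⁻¹‖ = (2 * π)⁻¹ := by
    simp [norm_inv, Complex.norm_I, abs_of_pos Real.pi_pos]
  set M : ℕ → ℝ := fun n ↦ (2 * π)⁻¹ * ((‖bot (n + 1)‖ + ‖bot n‖) + (‖top (n + 1)‖ + ‖top n‖) +
    (ap (n + 1) - ap n) + (am (n + 1) - am n)) with hM
  have hM_sum : Summable M :=
    (((((summable_nat_add_iff 1).2 hbot_sum).add hbot_sum).add
      (((summable_nat_add_iff 1).2 htop_sum).add htop_sum)).add hap_sum |>.add ham_sum).mul_left _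
  have hinc : ∀ n, ‖burnolInvZetaResiduePartialSum G T (n + 1) - burnolInvZetaResiduePartialSum G T n‖ ≤
      M n := by
    intro n
    rw [hSeq (n + 1), hSeq n, ← mul_sub, norm_mul, hnorm2πI, hM]
    simp only
    gcongr
    have e : bot (n + 1) - top (n + 1) + I * rgt (n + 1) - I * lft (n + 1) -
        (bot n - top n + I * rgt n - I * lft n) =
        (bot (n + 1) - bot n) - (top (n + 1) - top n) + I * (rgt (n + 1) - rgt n) -
          I * (lft (n + 1) - lft n) := by ring
    rw [e]
    calc _ ≤ ‖bot (n + 1) - bot n‖ + ‖top (n + 1) - top n‖ + ‖rgt (n + 1) - rgt n‖ +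
          ‖lft (n + 1) - lft n‖ := htri _ _ _ _
      _ ≤ (‖bot (n + 1)‖ + ‖bot n‖) + (‖top (n + 1)‖ + ‖top n‖) + (ap (n + 1) - ap n) +
          (am (n + 1) - am n) := by
          gcongr
          · exact norm_sub_le _ _
          · exact norm_sub_le _ _
          · exact hrgt_le n
          · exact hlft_le n
  exact ⟨Summable.of_nonneg_of_le (fun n ↦ norm_nonneg _) hinc hM_sum, hlim⟩

end BurnolResidueSum

/-- **Burnol 2004b, Prop. 5.4 — DISCHARGED.** [cite: Burnol2004b, Prop. 5.4 (arXiv:math/0203120v7 p. 14, TeX l.1131–1174)] -/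
theorem Burnol2004b_prop5_4_holds : Burnol2004b_prop5_4 :=
  BurnolResidueSum.Burnol2004b_prop5_4_holds'

end Literature.NumberTheory.LFunctions
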